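import Literature.Geometry.Kaehler.ComplexTorusIntegralHodgeLatticePrimitiveSplitting
import HarnessLib

/-!
# The Lefschetz image lattice `θ ∧ Hdgᵖ(X, ℤ) ⊆ Hdgᵖ⁺¹(X, ℤ)`: a similarity of ratio `c = (q+1)(q+2)·d_{q+1}d_{q+2}`, its Gram matrix and
# discriminant, the discriminant/index recursion `disc(θ ∧ Hdgᵖ) · disc(Hdgᵖ⁺¹_prim) = [Hdgᵖ⁺¹ : θ ∧ Hdgᵖ ⊕ Hdgᵖ⁺¹_prim]² · disc Hdgᵖ⁺¹`,
# and a UNIFORM exponent for the integral Lefschetz decomposition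

Layer `Literature/Geometry/Kaehler`, namespace `Literature.Geometry.Kaehler.ComplexTorus`; lane `lit-hodgefound`
(Track 2 foundations library), seat p09, generation 47, row g47-#1. THEOREMS ONLY (0 definitions); no named fact, net debt 0.
Sequel of g45-#3 (`ComplexTorusIntegralHodgeLatticeLefschetzStep`, whose Lefschetz map, Lefschetz image and Gram identity were PRIVATE
engines of the one-step signature theorem) and of g46-#9 (`ComplexTorusIntegralHodgeLatticePrimitiveSplitting`: `Hdgᵖ⁺¹(X, ℤ) ⊇ P ⊕ P^⊥`
of finite index, `θ ∧ H^{2p}(X, ℤ) ∩ Hdgᵖ⁺¹ ⊆ P^⊥`). Here the Lefschetz map `T : Hdgᵖ(X, ℤ) → Hdgᵖ⁺¹(X, ℤ)`, `x ↦ x ∧ θ`, between the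
integral Hodge lattices of a polarised abelian variety (`g = j + 2 = (2p + 2) + q`, type `(d₁, …, d_g)`) becomes a PUBLIC object, and
its image `L₂ = θ ∧ Hdgᵖ(X, ℤ)` — the integral Lefschetz part of `Hdgᵖ⁺¹(X, ℤ)` before saturation — is computed as a lattice:

* §1 `T` exists as a `ℤ`-linear map and is a SIMILARITY: `B_{2p+2}(T x, T y) = c · B_{2p}(x, y)`, `c = (q+1)(q+2)·d_{q+1}·d_{q+2}`
  (Lange (5.22) with the contents of `θ^{∧q}` made explicit); it is injective (`B_{2p}∣Hdgᵖ(X, ℤ)` is non-degenerate, g46-#1).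
* §2 Inside `M = Hdgᵖ⁺¹(X, ℤ)`: `L₂^⊥ = P` (the primitive Hodge lattice) EXACTLY, `L₂ ⊆ P^⊥`, `L₂ ∩ P = 0`, and `rk L₂ = rk Hdgᵖ(X, ℤ) = rk P^⊥`
  (Voisin's Lemma 6.31 on the lattice; Lange §7.3.2 (3)).
* §3 In the basis `T b'` of `L₂` the Gram matrix of `B_{2p+2}` is `c · G'` (`G'` the Gram matrix of `B_{2p}∣Hdgᵖ(X, ℤ)` in `b'`), so
  **`disc(θ ∧ Hdgᵖ(X, ℤ)) = c^{rk Hdgᵖ} · disc Hdgᵖ(X, ℤ) ≠ 0`**.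
* §4 THE DISCRIMINANT/INDEX RECURSION along the Lefschetz ladder (Huybrechts (0.2), Kitaoka 5.3.3, for the sublattice `L₂` with `L₂^⊥ = P`):
  **`c^{rk Hdgᵖ} · disc Hdgᵖ(X, ℤ) · disc Hdgᵖ⁺¹(X, ℤ)_prim = [Hdgᵖ⁺¹(X, ℤ) : θ ∧ Hdgᵖ(X, ℤ) ⊕ Hdgᵖ⁺¹(X, ℤ)_prim]² · disc Hdgᵖ⁺¹(X, ℤ)`**, the index
  being positive and dividing `c^{rk Hdgᵖ} · |disc Hdgᵖ(X, ℤ)|`; `[Hdgᵖ⁺¹ : P ⊕ P^⊥] ∣ [Hdgᵖ⁺¹ : L₂ ⊕ P]`.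
* §5 A UNIFORM EXPONENT: with `N = [Hdgᵖ⁺¹(X, ℤ) : θ ∧ Hdgᵖ(X, ℤ) ⊕ P]`, **`N · P^⊥ ⊆ θ ∧ Hdgᵖ(X, ℤ)`** (so `P^⊥/(θ ∧ Hdgᵖ)` is a finite group of
  exponent dividing `N`; g46-#11 gave `P^⊥ = (θ ∧ Hdgᵖ)^{sat}` with a multiplier depending on the class), and the data-free form:
  **there is ONE `N ≥ 1` with `N·x = y₀ + β ∧ θ` (`y₀` primitive integral Hodge, `β ∈ Hdgᵖ(X, ℤ)`) for EVERY `x ∈ Hdgᵖ⁺¹(X, ℤ)`** — the integral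
  Lefschetz decomposition of Hodge classes (Voisin Rem. 6.27, Lange §7.3.2 (3)) holds with bounded denominators (g45-#3 §1 had `N = N(x)`).

## Dictionary

`X = E/Φ(ℤ^ι)` polarised of type `d` (`IsPolarizationType Φ η d`, `hη : IsRiemannForm Φ η`), `θ = ofRealForm η`, `g = j + 2 = (2p + 2) + q`
(`hpq`), `γ = γ_q`, `γ' = γ_{q+2}` the integral minimal classes (`hγ`, `hγ'`: `q!·d₁⋯d_q·γ_q = θ^{∧q}`), `e` an orientation,
`B = B_{2p+2} = ⟨·, γ_q ∧ ·⟩_e` on `H^{2p+2}(X, ℤ) = integralForms Φ (2p+2)` (`hB`), `B' = B_{2p} = ⟨·, γ_{q+2} ∧ ·⟩_e` on `H^{2p}(X, ℤ)` (`hB'`);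
`M ⊆ H^{2p+2}(X, ℤ)` and `M' ⊆ H^{2p}(X, ℤ)` the integral Hodge lattices, given (§§1–5) by the membership predicates `hM`, `hM'` ("of type
`(p+1, p+1)`", "of type `(p, p)`") — satisfied by the concrete lattices `AddSubgroup.toIntSubmodule ((integralHodgeClassesIn Φ _ _).addSubgroupOf _)`
(`mem_toIntSubmodule_integralHodgeClassesIn_iff`), which §6 uses; `T : M' →ₗ[ℤ] M` any map with `T x = x ∧ θ` (`hT`; it exists, §1);
`L₂ ⊆ M` any submodule with `u ∈ L₂ ⟺ ∃ w, T w = u` (`hmemL₂`; `LinearMap.range T`); `P ⊆ M` any submodule with `z ∈ P ⟺ z` primitive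
(`hP`, membership in `primitiveForms η (2p+2)`; it exists, g46-#9 `exists_submodule_mem_iff_mem_primitiveForms`); `P^⊥ = (B.restrict M).orthogonal P`;
`c = (q+1)(q+2)·d_{q+1}·d_{q+2}`.

## References

* [cite: VoisinHodgeI2002, §6.2.3 Lemma 6.26, Rem. 6.27 (PDF p. 126); §6.3.2 Lemma 6.31, Thm. 6.32 (PDF p. 128); §7.1.2 (PDF p. 134)]
* [cite: Lange2023AbelianVarietiesComplex, §5.4.1 Thm. 5.4.2 and (5.22)–(5.23) (PDF p. 275); §7.2.2; §7.3.2 (1), (3); §2.5.3 Cor. 2.5.17 (PDF p. 135)]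
* [cite: Huybrechts2016K3, Ch. 14 §0.1 (0.1), (0.2); §0.2]
* [cite: Kitaoka1993, Ch. 5 Prop. 5.3.3 (proof)]
* [cite: Serre1973, Ch. V §1.3.2]
-/

noncomputable section

-- `Module ℂ` / `SMulZeroClass ℂ` synthesis on `E [⋀^Fin k]→L[ℝ] ℂ` (as in `ComplexTorusLefschetzDecomposition`)
set_option maxSynthPendingDepth 3

open Module Function Complex
open LinearMap (BilinForm)
open Literature.LinearAlgebra.Alternating
open Literature.Analysis.Complex (IsOfTypeAt typeSubmodule)

namespace Literature.Geometry.Kaehler.ComplexTorus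

/-! ## §1 The Lefschetz map `T : Hdgᵖ(X, ℤ) → Hdgᵖ⁺¹(X, ℤ)`, `x ↦ x ∧ θ`: existence, similarity, injectivity -/

section LefschetzMap

variable {ι : Type*} [Fintype ι] [DecidableEq ι] {E : Type*} [NormedAddCommGroup E] [NormedSpace ℂ E]
  {Φ : (ι → ℝ) ≃L[ℝ] E} {j n p q : ℕ} {η : E [⋀^Fin 2]→L[ℝ] ℝ} {d : Fin (j + 2) → ℕ}

omit [Fintype ι] [DecidableEq ι] in
/-- **The Lefschetz map on the integral Hodge lattices exists as a `ℤ`-linear map** `T : Hdgᵖ(X, ℤ) → Hdgᵖ⁺¹(X, ℤ)`, `T x = x ∧ θ`: `θ = η_ℂ` is an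
integral class of type `(1, 1)`, so `x ∧ θ` is integral of type `(p+1, p+1)` for `x` integral of type `(p, p)` (`L` acts on integral cohomology
and has bidegree `(1, 1)`). [cite: VoisinHodgeI2002, §6.2.3 Lemma 6.26; §7.1.2 (PDF p. 134)] [cite: Lange2023AbelianVarietiesComplex, §5.4.1 (5.22) (PDF p. 275); §7.3.2] -/
theorem IsRiemannForm.exists_lefschetz_linearMap (hη : IsRiemannForm Φ η) {M : Submodule ℤ ↥(integralForms Φ (2 * p + 2))}
    (hM : ∀ x : ↥(integralForms Φ (2 * p + 2)), x ∈ M ↔ IsOfTypeAt (p + 1) (p + 1) (x : E [⋀^Fin (2 * p + 2)]→L[ℝ] ℂ))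
    {M' : Submodule ℤ ↥(integralForms Φ (2 * p))}
    (hM' : ∀ x : ↥(integralForms Φ (2 * p)), x ∈ M' ↔ IsOfTypeAt p p (x : E [⋀^Fin (2 * p)]→L[ℝ] ℂ)) :
    ∃ T : ↥M' →ₗ[ℤ] ↥M, ∀ x : ↥M', (((T x : ↥M) : ↥(integralForms Φ (2 * p + 2))) : E [⋀^Fin (2 * p + 2)]→L[ℝ] ℂ) =
      (((x : ↥M') : ↥(integralForms Φ (2 * p))) : E [⋀^Fin (2 * p)]→L[ℝ] ℂ).wedge (ofRealForm η : E [⋀^Fin 2]→L[ℝ] ℂ) := by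
  have hθZ : (ofRealForm η : E [⋀^Fin 2]→L[ℝ] ℂ) ∈ integralForms Φ 2 := ofRealForm_mem_integralForms_two Φ hη.isNSForm
  have hθT : IsOfTypeAt 1 1 (ofRealForm η : E [⋀^Fin 2]→L[ℝ] ℂ) := isOfTypeAt_one_one_ofRealForm hη.1
  let T₀ : ↥(integralForms Φ (2 * p)) →ₗ[ℤ] ↥(integralForms Φ (2 * p + 2)) :=
    (((AddMonoidHom.mk' (fun x : E [⋀^Fin (2 * p)]→L[ℝ] ℂ ↦ (x.wedge (ofRealForm η : E [⋀^Fin 2]→L[ℝ] ℂ) : E [⋀^Fin (2 * p + 2)]→L[ℝ] ℂ))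
      (fun x y ↦ ContinuousAlternatingMap.wedge_add_left x y _)).comp (integralForms Φ (2 * p)).subtype).codRestrict
      (integralForms Φ (2 * p + 2)) fun x ↦ wedge_mem_integralForms Φ x.2 hθZ).toIntLinearMap
  have hT₀M : ∀ x : ↥M', (T₀.comp M'.subtype) x ∈ M := fun x ↦ (hM _).2 (((hM' _).1 x.2).wedge hθT)
  exact ⟨LinearMap.codRestrict M (T₀.comp M'.subtype) hT₀M, fun _ ↦ rfl⟩

/-- **The Lefschetz map is a similarity of ratio `c = (q+1)(q+2)·d_{q+1}·d_{q+2}`: `B_{2p+2}(T x, T y) = c · B_{2p}(x, y)`** on the integral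
Hodge lattices (`⟨x ∧ θ, γ_q ∧ (y ∧ θ)⟩ = c·⟨x, γ_{q+2} ∧ y⟩`, `θ² ∧ γ_q = (q+1)(q+2)d_{q+1}d_{q+2}·γ_{q+2}`): on `θ ∧ Hdgᵖ(X, ℤ)` the Lefschetz
form of degree `2p + 2` IS the Lefschetz form of degree `2p`, scaled by `c` (Voisin: on `L H^{k−2}` the form `Q_k` induces `Q_{k−2}` up to sign;
Lange (5.22)). [cite: VoisinHodgeI2002, §6.3.2 Lemma 6.31 (PDF p. 128)] [cite: Lange2023AbelianVarietiesComplex, §5.4.1 (5.22) (PDF p. 275); §2.5.3 Cor. 2.5.17 (PDF p. 135)] -/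
theorem IsPolarizationType.apply_lefschetz_linearMap (hd : IsPolarizationType Φ η d) (hη : IsRiemannForm Φ η) (hq : q ≤ j + 2)
    {γ : E [⋀^Fin (2 * q)]→L[ℝ] ℂ} (hγ : wedgePow (ofRealForm η) q = ((q.factorial * ∏ i : Fin q, d (Fin.castLE hq i) : ℕ) : ℂ) • γ)
    (hq2 : q + 1 + 1 ≤ j + 2) {γ' : E [⋀^Fin (2 * (q + 1 + 1))]→L[ℝ] ℂ}
    (hγ' : wedgePow (ofRealForm η) (q + 1 + 1) =
      (((q + 1 + 1).factorial * ∏ i : Fin (q + 1 + 1), d (Fin.castLE hq2 i) : ℕ) : ℂ) • γ')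
    (e : Fin n ≃ ι) (hn : 2 * p + 2 + (2 * q + (2 * p + 2)) = n) (hn₂ : 2 * p + (2 * (q + 1 + 1) + 2 * p) = n)
    {B : BilinForm ℤ ↥(integralForms Φ (2 * p + 2))}
    (hB : ∀ x y : ↥(integralForms Φ (2 * p + 2)),
      ((B x y : ℤ) : ℂ) = poincarePairing Φ e hn (x : E [⋀^Fin (2 * p + 2)]→L[ℝ] ℂ) (γ.wedge (y : E [⋀^Fin (2 * p + 2)]→L[ℝ] ℂ)))
    {B' : BilinForm ℤ ↥(integralForms Φ (2 * p))}
    (hB' : ∀ x y : ↥(integralForms Φ (2 * p)),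
      ((B' x y : ℤ) : ℂ) = poincarePairing Φ e hn₂ (x : E [⋀^Fin (2 * p)]→L[ℝ] ℂ) (γ'.wedge (y : E [⋀^Fin (2 * p)]→L[ℝ] ℂ)))
    {M : Submodule ℤ ↥(integralForms Φ (2 * p + 2))} {M' : Submodule ℤ ↥(integralForms Φ (2 * p))} (T : ↥M' →ₗ[ℤ] ↥M)
    (hT : ∀ x : ↥M', (((T x : ↥M) : ↥(integralForms Φ (2 * p + 2))) : E [⋀^Fin (2 * p + 2)]→L[ℝ] ℂ) =
      (((x : ↥M') : ↥(integralForms Φ (2 * p))) : E [⋀^Fin (2 * p)]→L[ℝ] ℂ).wedge (ofRealForm η : E [⋀^Fin 2]→L[ℝ] ℂ)) (x y : ↥M') :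
    B (T x : ↥M) (T y : ↥M) = (((q + 1) * (q + 2) * d (Fin.castLE hq2 (Fin.last q).castSucc) * d (Fin.castLE hq2 (Fin.last (q + 1))) : ℕ) : ℤ) *
      B' (x : ↥(integralForms Φ (2 * p))) (y : ↥(integralForms Φ (2 * p))) := by
  apply Int.cast_injective (α := ℂ)
  rw [hB, Int.cast_mul, Int.cast_natCast, hB', hT, hT]
  exact hd.poincarePairing_wedge_ofRealForm_wedge_wedge_ofRealForm_of_eq_content_smul hη hq hγ hq2 hγ' e hn hn₂ _ _

/-- The ratio `c = (q+1)(q+2)·d_{q+1}·d_{q+2}` of the Lefschetz similarity is a positive integer (`d_i ≥ 1`).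
[cite: Lange2023AbelianVarietiesComplex, §1.5.1 (PDF p. 51); §5.4.1 (5.22)] -/
theorem IsPolarizationType.lefschetz_ratio_pos (hd : IsPolarizationType Φ η d) (hη : IsRiemannForm Φ η) (hq2 : q + 1 + 1 ≤ j + 2) :
    (0 : ℤ) < (((q + 1) * (q + 2) * d (Fin.castLE hq2 (Fin.last q).castSucc) * d (Fin.castLE hq2 (Fin.last (q + 1))) : ℕ) : ℤ) :=
  Int.natCast_pos.2 (Nat.mul_pos (Nat.mul_pos (Nat.mul_pos (by omega) (by omega)) (hd.pos hη _)) (hd.pos hη _))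

/-- **The Lefschetz map `T : Hdgᵖ(X, ℤ) → Hdgᵖ⁺¹(X, ℤ)` is injective** as soon as `B_{2p}∣Hdgᵖ(X, ℤ)` is non-degenerate (which it always is,
g46-#1): `B(T x, T y) = c·B'(x, y)` with `c ≠ 0`, so `T x = 0` forces `B'(x, ·) = 0` on `Hdgᵖ(X, ℤ)` (hard Lefschetz on the lattice:
`L : H^{2p} → H^{2p+2}` is injective for `2p + 2 ≤ g`). [cite: VoisinHodgeI2002, §6.2.3 Lemma 6.26, Rem. 6.27] [cite: Lange2023AbelianVarietiesComplex, §5.4.1 Thm. 5.4.2 and (5.22) (PDF p. 275); §7.3.2 (1)] -/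
theorem IsPolarizationType.lefschetz_linearMap_injective (hd : IsPolarizationType Φ η d) (hη : IsRiemannForm Φ η) (hq : q ≤ j + 2)
    {γ : E [⋀^Fin (2 * q)]→L[ℝ] ℂ} (hγ : wedgePow (ofRealForm η) q = ((q.factorial * ∏ i : Fin q, d (Fin.castLE hq i) : ℕ) : ℂ) • γ)
    (hq2 : q + 1 + 1 ≤ j + 2) {γ' : E [⋀^Fin (2 * (q + 1 + 1))]→L[ℝ] ℂ}
    (hγ' : wedgePow (ofRealForm η) (q + 1 + 1) =
      (((q + 1 + 1).factorial * ∏ i : Fin (q + 1 + 1), d (Fin.castLE hq2 i) : ℕ) : ℂ) • γ')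
    (e : Fin n ≃ ι) (hn : 2 * p + 2 + (2 * q + (2 * p + 2)) = n) (hn₂ : 2 * p + (2 * (q + 1 + 1) + 2 * p) = n)
    {B : BilinForm ℤ ↥(integralForms Φ (2 * p + 2))}
    (hB : ∀ x y : ↥(integralForms Φ (2 * p + 2)),
      ((B x y : ℤ) : ℂ) = poincarePairing Φ e hn (x : E [⋀^Fin (2 * p + 2)]→L[ℝ] ℂ) (γ.wedge (y : E [⋀^Fin (2 * p + 2)]→L[ℝ] ℂ)))
    {B' : BilinForm ℤ ↥(integralForms Φ (2 * p))}
    (hB' : ∀ x y : ↥(integralForms Φ (2 * p)),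
      ((B' x y : ℤ) : ℂ) = poincarePairing Φ e hn₂ (x : E [⋀^Fin (2 * p)]→L[ℝ] ℂ) (γ'.wedge (y : E [⋀^Fin (2 * p)]→L[ℝ] ℂ)))
    {M : Submodule ℤ ↥(integralForms Φ (2 * p + 2))} {M' : Submodule ℤ ↥(integralForms Φ (2 * p))}
    (hM'n : (B'.restrict M').Nondegenerate) (T : ↥M' →ₗ[ℤ] ↥M)
    (hT : ∀ x : ↥M', (((T x : ↥M) : ↥(integralForms Φ (2 * p + 2))) : E [⋀^Fin (2 * p + 2)]→L[ℝ] ℂ) =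
      (((x : ↥M') : ↥(integralForms Φ (2 * p))) : E [⋀^Fin (2 * p)]→L[ℝ] ℂ).wedge (ofRealForm η : E [⋀^Fin 2]→L[ℝ] ℂ)) :
    Injective T := by
  have hc0 := (hd.lefschetz_ratio_pos hη hq2 (q := q)).ne'
  have hBT := hd.apply_lefschetz_linearMap hη hq hγ hq2 hγ' e hn hn₂ hB hB' T hT
  rw [← LinearMap.ker_eq_bot, LinearMap.ker_eq_bot']
  intro x hx
  refine hM'n.1 x fun y ↦ ?_
  have h1 : B (T x : ↥M) (T y : ↥M) = 0 := by rw [hx, ZeroMemClass.coe_zero]; exact LinearMap.map_zero₂ B _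
  rw [hBT] at h1
  exact (mul_eq_zero.1 h1).resolve_left hc0

/-- **`rk (θ ∧ Hdgᵖ(X, ℤ)) = rk Hdgᵖ(X, ℤ)`**: the Lefschetz image `L₂ = T(Hdgᵖ(X, ℤ))` (`hmemL₂`) is isomorphic to `Hdgᵖ(X, ℤ)` (`T` injective).
[cite: Lange2023AbelianVarietiesComplex, §7.3.2 (1), (3); §5.4.1 Thm. 5.4.2 (PDF p. 275)] [cite: VoisinHodgeI2002, §6.2.3 Lemma 6.26] -/
theorem IsPolarizationType.finrank_lefschetzImage_eq (hd : IsPolarizationType Φ η d) (hη : IsRiemannForm Φ η) (hq : q ≤ j + 2)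
    {γ : E [⋀^Fin (2 * q)]→L[ℝ] ℂ} (hγ : wedgePow (ofRealForm η) q = ((q.factorial * ∏ i : Fin q, d (Fin.castLE hq i) : ℕ) : ℂ) • γ)
    (hq2 : q + 1 + 1 ≤ j + 2) {γ' : E [⋀^Fin (2 * (q + 1 + 1))]→L[ℝ] ℂ}
    (hγ' : wedgePow (ofRealForm η) (q + 1 + 1) =
      (((q + 1 + 1).factorial * ∏ i : Fin (q + 1 + 1), d (Fin.castLE hq2 i) : ℕ) : ℂ) • γ')
    (e : Fin n ≃ ι) (hn : 2 * p + 2 + (2 * q + (2 * p + 2)) = n) (hn₂ : 2 * p + (2 * (q + 1 + 1) + 2 * p) = n)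
    {B : BilinForm ℤ ↥(integralForms Φ (2 * p + 2))}
    (hB : ∀ x y : ↥(integralForms Φ (2 * p + 2)),
      ((B x y : ℤ) : ℂ) = poincarePairing Φ e hn (x : E [⋀^Fin (2 * p + 2)]→L[ℝ] ℂ) (γ.wedge (y : E [⋀^Fin (2 * p + 2)]→L[ℝ] ℂ)))
    {B' : BilinForm ℤ ↥(integralForms Φ (2 * p))}
    (hB' : ∀ x y : ↥(integralForms Φ (2 * p)),
      ((B' x y : ℤ) : ℂ) = poincarePairing Φ e hn₂ (x : E [⋀^Fin (2 * p)]→L[ℝ] ℂ) (γ'.wedge (y : E [⋀^Fin (2 * p)]→L[ℝ] ℂ)))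
    {M : Submodule ℤ ↥(integralForms Φ (2 * p + 2))} {M' : Submodule ℤ ↥(integralForms Φ (2 * p))}
    (hM'n : (B'.restrict M').Nondegenerate) (T : ↥M' →ₗ[ℤ] ↥M)
    (hT : ∀ x : ↥M', (((T x : ↥M) : ↥(integralForms Φ (2 * p + 2))) : E [⋀^Fin (2 * p + 2)]→L[ℝ] ℂ) =
      (((x : ↥M') : ↥(integralForms Φ (2 * p))) : E [⋀^Fin (2 * p)]→L[ℝ] ℂ).wedge (ofRealForm η : E [⋀^Fin 2]→L[ℝ] ℂ))
    {L₂ : Submodule ℤ ↥M} (hmemL₂ : ∀ u : ↥M, u ∈ L₂ ↔ ∃ w : ↥M', T w = u) :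
    finrank ℤ ↥L₂ = finrank ℤ ↥M' := by
  have hTinj := hd.lefschetz_linearMap_injective hη hq hγ hq2 hγ' e hn hn₂ hB hB' hM'n T hT
  have hrange : LinearMap.range T = L₂ := by
    ext u
    rw [LinearMap.mem_range]
    exact (hmemL₂ u).symm
  rw [← hrange]
  exact (LinearEquiv.ofInjective T hTinj).finrank_eq.symm

end LefschetzMap

/-! ## §2 Inside `Hdgᵖ⁺¹(X, ℤ)`: `(θ ∧ Hdgᵖ)^⊥ = P`, `θ ∧ Hdgᵖ ⊆ P^⊥`, `θ ∧ Hdgᵖ ∩ P = 0` -/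

section Orthogonality

variable {ι : Type*} [Fintype ι] [DecidableEq ι] {E : Type*} [NormedAddCommGroup E] [NormedSpace ℂ E]
  {Φ : (ι → ℝ) ≃L[ℝ] E} {j n p q : ℕ} {η : E [⋀^Fin 2]→L[ℝ] ℝ} {d : Fin (j + 2) → ℕ}

/-- **The Lefschetz classes are orthogonal to the primitive Hodge classes over `ℤ`: `θ ∧ Hdgᵖ(X, ℤ) ⊆ P^⊥`** inside `Hdgᵖ⁺¹(X, ℤ)` (`B(z, w ∧ θ) =
⟨w ∧ θ, γ_q ∧ z⟩ = 0` for `z` primitive: `θ^{∧(q+1)} ∧ z = 0`; Voisin's Lemma 6.31). No non-degeneracy hypothesis is needed for this inclusion.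
[cite: VoisinHodgeI2002, §6.3.2 Lemma 6.31 (PDF p. 128); §6.2.3 Rem. 6.27] [cite: Lange2023AbelianVarietiesComplex, §7.3.2 (3); §5.4.1 (5.22) (PDF p. 275)] -/
theorem IsPolarizationType.lefschetzImage_le_orthogonal_primitive (hd : IsPolarizationType Φ η d) (hη : IsRiemannForm Φ η)
    (hpq : 2 * p + 2 + q = j + 2) (hq : q ≤ j + 2) {γ : E [⋀^Fin (2 * q)]→L[ℝ] ℂ}
    (hγ : wedgePow (ofRealForm η) q = ((q.factorial * ∏ i : Fin q, d (Fin.castLE hq i) : ℕ) : ℂ) • γ)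
    (e : Fin n ≃ ι) (hn : 2 * p + 2 + (2 * q + (2 * p + 2)) = n) {B : BilinForm ℤ ↥(integralForms Φ (2 * p + 2))}
    (hB : ∀ x y : ↥(integralForms Φ (2 * p + 2)),
      ((B x y : ℤ) : ℂ) = poincarePairing Φ e hn (x : E [⋀^Fin (2 * p + 2)]→L[ℝ] ℂ) (γ.wedge (y : E [⋀^Fin (2 * p + 2)]→L[ℝ] ℂ)))
    {M : Submodule ℤ ↥(integralForms Φ (2 * p + 2))} {M' : Submodule ℤ ↥(integralForms Φ (2 * p))} (T : ↥M' →ₗ[ℤ] ↥M)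
    (hT : ∀ x : ↥M', (((T x : ↥M) : ↥(integralForms Φ (2 * p + 2))) : E [⋀^Fin (2 * p + 2)]→L[ℝ] ℂ) =
      (((x : ↥M') : ↥(integralForms Φ (2 * p))) : E [⋀^Fin (2 * p)]→L[ℝ] ℂ).wedge (ofRealForm η : E [⋀^Fin 2]→L[ℝ] ℂ))
    {L₂ : Submodule ℤ ↥M} (hmemL₂ : ∀ u : ↥M, u ∈ L₂ ↔ ∃ w : ↥M', T w = u) {P : Submodule ℤ ↥M}
    (hP : ∀ z : ↥M, z ∈ P ↔ (((z : ↥M) : ↥(integralForms Φ (2 * p + 2))) : E [⋀^Fin (2 * p + 2)]→L[ℝ] ℂ) ∈ primitiveForms η (2 * p + 2)) :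
    L₂ ≤ (B.restrict M).orthogonal P := by
  haveI : FiniteDimensional ℝ E := Module.Finite.equiv Φ.toLinearEquiv
  haveI : FiniteDimensional ℂ E := Module.Finite.of_restrictScalars_finite ℝ ℂ E
  have hBs : B.IsSymm := hd.isSymm_of_eq_poincarePairing_wedge_of_even hη ⟨p + 1, by ring⟩ hpq hq hγ e hn hB
  intro u hu
  obtain ⟨w, rfl⟩ := (hmemL₂ u).1 hu
  rw [LinearMap.BilinForm.mem_orthogonal_iff]
  intro z hz
  have hzP : (wedgePow (ofRealForm η) (q + 1)).wedge (((z : ↥M) : ↥(integralForms Φ (2 * p + 2))) : E [⋀^Fin (2 * p + 2)]→L[ℝ] ℂ) = 0 :=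
    (hd.mem_primitiveForms_iff_wedgePow_wedge_eq_zero hpq _).1 ((hP z).1 hz)
  change B ((z : ↥M) : ↥(integralForms Φ (2 * p + 2))) ((T w : ↥M) : ↥(integralForms Φ (2 * p + 2))) = 0
  rw [← hBs.eq]
  apply Int.cast_injective (α := ℂ)
  rw [hB, hT, Int.cast_zero]
  exact (hd.forall_poincarePairing_wedge_ofRealForm_wedge_eq_zero_iff_of_eq_content_smul hη hq hγ e hn _).2 hzP _
    ((w : ↥M') : ↥(integralForms Φ (2 * p))).2

/-- **`(θ ∧ Hdgᵖ(X, ℤ))^⊥ = ker(θ^{∧(q+1)} ∧ ·)` inside `Hdgᵖ⁺¹(X, ℤ)`**: an integral Hodge class `z` is `B_{2p+2}`-orthogonal to the Lefschetz image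
`L₂ = θ ∧ Hdgᵖ(X, ℤ)` iff it is primitive. `⊇`: Lemma 6.31 (`lefschetzImage_le_orthogonal_primitive`); `⊆`: by the integral Lefschetz
decomposition `N·z = y₀ + β ∧ θ` (g45-#3 §1, `β ∈ Hdgᵖ(X, ℤ)`), `B(w ∧ θ, N·z) = c·B'(w, β)` for all `w ∈ Hdgᵖ(X, ℤ)` and the non-degeneracy of
`B'∣Hdgᵖ(X, ℤ)` give `β = 0`, so `N·z = y₀` is primitive. (The public form of g45-#3's engine.)
[cite: VoisinHodgeI2002, §6.2.3 Rem. 6.27; §6.3.2 Lemma 6.31 (PDF p. 128)] [cite: Lange2023AbelianVarietiesComplex, §7.3.2 (3); §5.4.1 (5.22) (PDF p. 275)] -/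
theorem IsPolarizationType.mem_orthogonal_lefschetzImage_iff_wedgePow_wedge_eq_zero (hd : IsPolarizationType Φ η d)
    (hη : IsRiemannForm Φ η) (hpq : 2 * p + 2 + q = j + 2) (hq : q ≤ j + 2) {γ : E [⋀^Fin (2 * q)]→L[ℝ] ℂ}
    (hγ : wedgePow (ofRealForm η) q = ((q.factorial * ∏ i : Fin q, d (Fin.castLE hq i) : ℕ) : ℂ) • γ)
    (hq2 : q + 1 + 1 ≤ j + 2) {γ' : E [⋀^Fin (2 * (q + 1 + 1))]→L[ℝ] ℂ}
    (hγ' : wedgePow (ofRealForm η) (q + 1 + 1) =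
      (((q + 1 + 1).factorial * ∏ i : Fin (q + 1 + 1), d (Fin.castLE hq2 i) : ℕ) : ℂ) • γ')
    (e : Fin n ≃ ι) (hn : 2 * p + 2 + (2 * q + (2 * p + 2)) = n) (hn₂ : 2 * p + (2 * (q + 1 + 1) + 2 * p) = n)
    {B : BilinForm ℤ ↥(integralForms Φ (2 * p + 2))}
    (hB : ∀ x y : ↥(integralForms Φ (2 * p + 2)),
      ((B x y : ℤ) : ℂ) = poincarePairing Φ e hn (x : E [⋀^Fin (2 * p + 2)]→L[ℝ] ℂ) (γ.wedge (y : E [⋀^Fin (2 * p + 2)]→L[ℝ] ℂ)))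
    {B' : BilinForm ℤ ↥(integralForms Φ (2 * p))}
    (hB' : ∀ x y : ↥(integralForms Φ (2 * p)),
      ((B' x y : ℤ) : ℂ) = poincarePairing Φ e hn₂ (x : E [⋀^Fin (2 * p)]→L[ℝ] ℂ) (γ'.wedge (y : E [⋀^Fin (2 * p)]→L[ℝ] ℂ)))
    {M : Submodule ℤ ↥(integralForms Φ (2 * p + 2))}
    (hM : ∀ x : ↥(integralForms Φ (2 * p + 2)), x ∈ M ↔ IsOfTypeAt (p + 1) (p + 1) (x : E [⋀^Fin (2 * p + 2)]→L[ℝ] ℂ))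
    {M' : Submodule ℤ ↥(integralForms Φ (2 * p))}
    (hM' : ∀ x : ↥(integralForms Φ (2 * p)), x ∈ M' ↔ IsOfTypeAt p p (x : E [⋀^Fin (2 * p)]→L[ℝ] ℂ))
    (hM'n : (B'.restrict M').Nondegenerate) (T : ↥M' →ₗ[ℤ] ↥M)
    (hT : ∀ x : ↥M', (((T x : ↥M) : ↥(integralForms Φ (2 * p + 2))) : E [⋀^Fin (2 * p + 2)]→L[ℝ] ℂ) =
      (((x : ↥M') : ↥(integralForms Φ (2 * p))) : E [⋀^Fin (2 * p)]→L[ℝ] ℂ).wedge (ofRealForm η : E [⋀^Fin 2]→L[ℝ] ℂ))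
    {L₂ : Submodule ℤ ↥M} (hmemL₂ : ∀ u : ↥M, u ∈ L₂ ↔ ∃ w : ↥M', T w = u) (z : ↥M) :
    z ∈ (B.restrict M).orthogonal L₂ ↔
      (wedgePow (ofRealForm η) (q + 1)).wedge (((z : ↥M) : ↥(integralForms Φ (2 * p + 2))) : E [⋀^Fin (2 * p + 2)]→L[ℝ] ℂ) = 0 := by
  have hc0 := (hd.lefschetz_ratio_pos hη hq2 (q := q)).ne'
  constructor
  · intro hz
    -- the integral Lefschetz decomposition of `z` up to `N`
    have hzH : (((z : ↥M) : ↥(integralForms Φ (2 * p + 2))) : E [⋀^Fin (2 * p + 2)]→L[ℝ] ℂ) ∈ integralHodgeClassesIn Φ (2 * p + 2) (p + 1) :=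
      ⟨((z : ↥M) : ↥(integralForms Φ (2 * p + 2))).2,
        (Literature.Analysis.Complex.mem_typeSubmodule_iff_isOfTypeAt (show p + 1 + (p + 1) = 2 * p + 2 by omega)).2
          ((hM _).1 (z : ↥M).2)⟩
    have Hdec := hd.exists_nsmul_eq_primitive_add_wedge_ofRealForm hη hpq hzH
    obtain ⟨N, hN, y₀, hy₀H, hy₀P, β, hβH, hdec⟩ := Hdec
    let βH : ↥(integralForms Φ (2 * p)) := ⟨β, hβH.1⟩
    have hβM' : βH ∈ M' := (hM' βH).2
      ((Literature.Analysis.Complex.mem_typeSubmodule_iff_isOfTypeAt (show p + p = 2 * p by omega)).1 hβH.2)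
    -- `B'(w, β) = 0` for every `w ∈ M'`
    have hβ0 : ∀ w : ↥M', B' (w : ↥(integralForms Φ (2 * p))) βH = 0 := by
      intro w
      -- `B(T w, N·z) = N · B(T w, z) = 0`
      have h1 : B (T w : ↥M) (N • ((z : ↥M) : ↥(integralForms Φ (2 * p + 2)))) = 0 := by
        have h2 : B (T w : ↥M) (z : ↥M) = 0 := (LinearMap.BilinForm.mem_orthogonal_iff.1 hz) _ ((hmemL₂ _).2 ⟨w, rfl⟩)
        rw [map_nsmul, h2, smul_zero]
      -- `B(T w, N·z) = ⟨w ∧ θ, γ ∧ y₀⟩ + c·B'(w, β)` and the first term vanishes (`y₀` primitive)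
      have h3 : ((B (T w : ↥M) (N • ((z : ↥M) : ↥(integralForms Φ (2 * p + 2)))) : ℤ) : ℂ) =
          (((q + 1) * (q + 2) * d (Fin.castLE hq2 (Fin.last q).castSucc) * d (Fin.castLE hq2 (Fin.last (q + 1))) : ℕ) : ℂ) *
            ((B' (w : ↥(integralForms Φ (2 * p))) βH : ℤ) : ℂ) := by
        rw [hB, hT, AddSubmonoidClass.coe_nsmul, ← Nat.cast_smul_eq_nsmul ℂ N, hdec, ContinuousAlternatingMap.wedge_add_right,
          map_add, (hd.forall_poincarePairing_wedge_ofRealForm_wedge_eq_zero_iff_of_eq_content_smul hη hq hγ e hn y₀).2 hy₀P _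
            ((w : ↥M') : ↥(integralForms Φ (2 * p))).2, zero_add, hB']
        exact hd.poincarePairing_wedge_ofRealForm_wedge_wedge_ofRealForm_of_eq_content_smul hη hq hγ hq2 hγ' e hn hn₂ _ _
      rw [h1, Int.cast_zero] at h3
      have h4 := (mul_eq_zero.1 h3.symm).resolve_left (by exact_mod_cast hc0)
      exact_mod_cast h4
    have hβz : (⟨βH, hβM'⟩ : ↥M') = 0 := hM'n.2 ⟨βH, hβM'⟩ fun w ↦ hβ0 w
    have hβ00 : β = 0 := congrArg (fun v : ↥M' ↦ (((v : ↥M') : ↥(integralForms Φ (2 * p))) : E [⋀^Fin (2 * p)]→L[ℝ] ℂ)) hβz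
    rw [hβ00, ContinuousAlternatingMap.zero_wedge, add_zero] at hdec
    -- `N · z = y₀` is primitive
    have h5 : (N : ℂ) • (wedgePow (ofRealForm η) (q + 1)).wedge (((z : ↥M) : ↥(integralForms Φ (2 * p + 2))) : E [⋀^Fin (2 * p + 2)]→L[ℝ] ℂ) = 0 := by
      rw [← Literature.NumberTheory.Transcendental.wedge_smul_right_complex, hdec, hy₀P]
    exact (smul_eq_zero.1 h5).resolve_left (by exact_mod_cast hN.ne')
  · intro hz
    rw [LinearMap.BilinForm.mem_orthogonal_iff]
    intro u hu
    obtain ⟨w, rfl⟩ := (hmemL₂ u).1 hu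
    change B (T w : ↥M) (z : ↥M) = 0
    apply Int.cast_injective (α := ℂ)
    rw [hB, hT, Int.cast_zero]
    exact (hd.forall_poincarePairing_wedge_ofRealForm_wedge_eq_zero_iff_of_eq_content_smul hη hq hγ e hn _).2 hz _
      ((w : ↥M') : ↥(integralForms Φ (2 * p))).2

/-- **`(θ ∧ Hdgᵖ(X, ℤ))^⊥ = Hdgᵖ⁺¹(X, ℤ)_prim` EXACTLY** (an equality of sublattices of `Hdgᵖ⁺¹(X, ℤ)`, not only up to finite index): the
`B_{2p+2}`-orthogonal of the Lefschetz image inside the integral Hodge lattice is the primitive Hodge lattice `P` — Voisin's orthogonal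
Lefschetz decomposition `Bᵖ⁺¹(X) = Bᵖ⁺¹(X)_prim ⊕ L Bᵖ(X)` read on the lattice. [cite: VoisinHodgeI2002, §6.3.2 Lemma 6.31 (PDF p. 128); §6.2.3 Rem. 6.27] [cite: Lange2023AbelianVarietiesComplex, §7.3.2 (3); §5.4.1 (5.22)–(5.23) (PDF p. 275)] -/
theorem IsPolarizationType.orthogonal_lefschetzImage_eq_primitive (hd : IsPolarizationType Φ η d)
    (hη : IsRiemannForm Φ η) (hpq : 2 * p + 2 + q = j + 2) (hq : q ≤ j + 2) {γ : E [⋀^Fin (2 * q)]→L[ℝ] ℂ}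
    (hγ : wedgePow (ofRealForm η) q = ((q.factorial * ∏ i : Fin q, d (Fin.castLE hq i) : ℕ) : ℂ) • γ)
    (hq2 : q + 1 + 1 ≤ j + 2) {γ' : E [⋀^Fin (2 * (q + 1 + 1))]→L[ℝ] ℂ}
    (hγ' : wedgePow (ofRealForm η) (q + 1 + 1) =
      (((q + 1 + 1).factorial * ∏ i : Fin (q + 1 + 1), d (Fin.castLE hq2 i) : ℕ) : ℂ) • γ')
    (e : Fin n ≃ ι) (hn : 2 * p + 2 + (2 * q + (2 * p + 2)) = n) (hn₂ : 2 * p + (2 * (q + 1 + 1) + 2 * p) = n)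
    {B : BilinForm ℤ ↥(integralForms Φ (2 * p + 2))}
    (hB : ∀ x y : ↥(integralForms Φ (2 * p + 2)),
      ((B x y : ℤ) : ℂ) = poincarePairing Φ e hn (x : E [⋀^Fin (2 * p + 2)]→L[ℝ] ℂ) (γ.wedge (y : E [⋀^Fin (2 * p + 2)]→L[ℝ] ℂ)))
    {B' : BilinForm ℤ ↥(integralForms Φ (2 * p))}
    (hB' : ∀ x y : ↥(integralForms Φ (2 * p)),
      ((B' x y : ℤ) : ℂ) = poincarePairing Φ e hn₂ (x : E [⋀^Fin (2 * p)]→L[ℝ] ℂ) (γ'.wedge (y : E [⋀^Fin (2 * p)]→L[ℝ] ℂ)))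
    {M : Submodule ℤ ↥(integralForms Φ (2 * p + 2))}
    (hM : ∀ x : ↥(integralForms Φ (2 * p + 2)), x ∈ M ↔ IsOfTypeAt (p + 1) (p + 1) (x : E [⋀^Fin (2 * p + 2)]→L[ℝ] ℂ))
    {M' : Submodule ℤ ↥(integralForms Φ (2 * p))}
    (hM' : ∀ x : ↥(integralForms Φ (2 * p)), x ∈ M' ↔ IsOfTypeAt p p (x : E [⋀^Fin (2 * p)]→L[ℝ] ℂ))
    (hM'n : (B'.restrict M').Nondegenerate) (T : ↥M' →ₗ[ℤ] ↥M)
    (hT : ∀ x : ↥M', (((T x : ↥M) : ↥(integralForms Φ (2 * p + 2))) : E [⋀^Fin (2 * p + 2)]→L[ℝ] ℂ) =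
      (((x : ↥M') : ↥(integralForms Φ (2 * p))) : E [⋀^Fin (2 * p)]→L[ℝ] ℂ).wedge (ofRealForm η : E [⋀^Fin 2]→L[ℝ] ℂ))
    {L₂ : Submodule ℤ ↥M} (hmemL₂ : ∀ u : ↥M, u ∈ L₂ ↔ ∃ w : ↥M', T w = u) {P : Submodule ℤ ↥M}
    (hP : ∀ z : ↥M, z ∈ P ↔ (((z : ↥M) : ↥(integralForms Φ (2 * p + 2))) : E [⋀^Fin (2 * p + 2)]→L[ℝ] ℂ) ∈ primitiveForms η (2 * p + 2)) :
    (B.restrict M).orthogonal L₂ = P := by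
  haveI : FiniteDimensional ℝ E := Module.Finite.equiv Φ.toLinearEquiv
  haveI : FiniteDimensional ℂ E := Module.Finite.of_restrictScalars_finite ℝ ℂ E
  ext z
  rw [hd.mem_orthogonal_lefschetzImage_iff_wedgePow_wedge_eq_zero hη hpq hq hγ hq2 hγ' e hn hn₂ hB hB' hM hM' hM'n T hT hmemL₂ z, hP z,
    hd.mem_primitiveForms_iff_wedgePow_wedge_eq_zero hpq]

/-- **Hodge–Riemann over `ℤ` on the primitive Hodge lattice `P ⊆ M`** (abstract `M` given by the type predicate): `(−1)ᵖ⁺¹·s·B(z, z) > 0` for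
`z ∈ P ∖ 0`, `s = sign·(−1)^q`. [cite: VoisinHodgeI2002, §6.3.2 Thm. 6.32 (PDF p. 128); §7.1.2 (PDF p. 134)] -/
private theorem hodgeRiemann_primitive₈₁ (hd : IsPolarizationType Φ η d) (hη : IsRiemannForm Φ η)
    (hpq : 2 * p + 2 + q = j + 2) (hq : q ≤ j + 2) {γ : E [⋀^Fin (2 * q)]→L[ℝ] ℂ}
    (hγ : wedgePow (ofRealForm η) q = ((q.factorial * ∏ i : Fin q, d (Fin.castLE hq i) : ℕ) : ℂ) • γ)
    (e : Fin n ≃ ι) (hn : 2 * p + 2 + (2 * q + (2 * p + 2)) = n) {B : BilinForm ℤ ↥(integralForms Φ (2 * p + 2))}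
    (hB : ∀ x y : ↥(integralForms Φ (2 * p + 2)),
      ((B x y : ℤ) : ℂ) = poincarePairing Φ e hn (x : E [⋀^Fin (2 * p + 2)]→L[ℝ] ℂ) (γ.wedge (y : E [⋀^Fin (2 * p + 2)]→L[ℝ] ℂ)))
    {M : Submodule ℤ ↥(integralForms Φ (2 * p + 2))}
    (hM : ∀ x : ↥(integralForms Φ (2 * p + 2)), x ∈ M ↔ IsOfTypeAt (p + 1) (p + 1) (x : E [⋀^Fin (2 * p + 2)]→L[ℝ] ℂ))
    {P : Submodule ℤ ↥M}
    (hP : ∀ z : ↥M, z ∈ P ↔ (((z : ↥M) : ↥(integralForms Φ (2 * p + 2))) : E [⋀^Fin (2 * p + 2)]→L[ℝ] ℂ) ∈ primitiveForms η (2 * p + 2))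
    {z : ↥M} (hz : z ∈ P) (hz0 : z ≠ 0) :
    0 < (-1) ^ (p + 1) * (orientationSign Φ e * (-1) ^ q) *
      B ((z : ↥M) : ↥(integralForms Φ (2 * p + 2))) ((z : ↥M) : ↥(integralForms Φ (2 * p + 2))) := by
  haveI : FiniteDimensional ℝ E := Module.Finite.equiv Φ.toLinearEquiv
  haveI : FiniteDimensional ℂ E := Module.Finite.of_restrictScalars_finite ℝ ℂ E
  have hzP : (wedgePow (ofRealForm η) (q + 1)).wedge (((z : ↥M) : ↥(integralForms Φ (2 * p + 2))) : E [⋀^Fin (2 * p + 2)]→L[ℝ] ℂ) = 0 :=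
    (hd.mem_primitiveForms_iff_wedgePow_wedge_eq_zero hpq _).1 ((hP z).1 hz)
  have hz0' : ((z : ↥M) : ↥(integralForms Φ (2 * p + 2))) ≠ 0 := fun h ↦ hz0 (Subtype.ext h)
  exact hd.hodgeRiemann_apply_self_pos_of_eq_poincarePairing_wedge hη hpq (show p + 1 + (p + 1) = 2 * p + 2 by omega) hq hγ e hn hB
    hzP ((hM _).1 (z : ↥M).2) hz0'

/-- `P ∩ P^⊥ = 0` and `B∣P` non-degenerate inside an abstract Hodge lattice `M` (`B` is anisotropic on `P` by Hodge–Riemann over `ℤ`).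
[cite: VoisinHodgeI2002, §6.3.2 Thm. 6.32 (PDF p. 128)] [cite: Huybrechts2016K3, Ch. 14 §0.2] -/
private theorem primitive_inf_orthogonal_eq_bot₈₁ (hd : IsPolarizationType Φ η d) (hη : IsRiemannForm Φ η)
    (hpq : 2 * p + 2 + q = j + 2) (hq : q ≤ j + 2) {γ : E [⋀^Fin (2 * q)]→L[ℝ] ℂ}
    (hγ : wedgePow (ofRealForm η) q = ((q.factorial * ∏ i : Fin q, d (Fin.castLE hq i) : ℕ) : ℂ) • γ)
    (e : Fin n ≃ ι) (hn : 2 * p + 2 + (2 * q + (2 * p + 2)) = n) {B : BilinForm ℤ ↥(integralForms Φ (2 * p + 2))}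
    (hB : ∀ x y : ↥(integralForms Φ (2 * p + 2)),
      ((B x y : ℤ) : ℂ) = poincarePairing Φ e hn (x : E [⋀^Fin (2 * p + 2)]→L[ℝ] ℂ) (γ.wedge (y : E [⋀^Fin (2 * p + 2)]→L[ℝ] ℂ)))
    {M : Submodule ℤ ↥(integralForms Φ (2 * p + 2))}
    (hM : ∀ x : ↥(integralForms Φ (2 * p + 2)), x ∈ M ↔ IsOfTypeAt (p + 1) (p + 1) (x : E [⋀^Fin (2 * p + 2)]→L[ℝ] ℂ))
    {P : Submodule ℤ ↥M}
    (hP : ∀ z : ↥M, z ∈ P ↔ (((z : ↥M) : ↥(integralForms Φ (2 * p + 2))) : E [⋀^Fin (2 * p + 2)]→L[ℝ] ℂ) ∈ primitiveForms η (2 * p + 2)) :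
    (∀ z : ↥M, z ∈ P → z ∈ (B.restrict M).orthogonal P → z = 0) ∧ ((B.restrict M).restrict P).Nondegenerate := by
  have h0 : ∀ z : ↥M, z ∈ P → B ((z : ↥M) : ↥(integralForms Φ (2 * p + 2))) ((z : ↥M) : ↥(integralForms Φ (2 * p + 2))) = 0 → z = 0 :=
    fun z hz hzz ↦ by
    by_contra hne
    have hpos := hodgeRiemann_primitive₈₁ hd hη hpq hq hγ e hn hB hM hP hz hne
    rw [hzz, mul_zero] at hpos
    exact lt_irrefl _ hpos
  refine ⟨fun z hz hzO ↦ h0 z hz ((LinearMap.BilinForm.mem_orthogonal_iff.1 hzO) z hz), ?_⟩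
  refine ⟨fun x hx ↦ ?_, fun y hy ↦ ?_⟩
  · exact Subtype.ext (h0 (x : ↥M) x.2 (hx x))
  · exact Subtype.ext (h0 (y : ↥M) y.2 (hy y))

/-- **The Lefschetz part and the primitive part have the same co-rank bookkeeping: `rk (θ ∧ Hdgᵖ(X, ℤ)) = rk P^⊥`** inside `Hdgᵖ⁺¹(X, ℤ)`
(`rk L₂ + rk L₂^⊥ = rk M` with `L₂^⊥ = P`, and `rk P + rk P^⊥ = rk M`, both restrictions being non-degenerate) — so `θ ∧ Hdgᵖ(X, ℤ) ⊆ P^⊥` is a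
sublattice of FULL RANK, i.e. of finite index (Lange (5.22): "of finite index"). [cite: Lange2023AbelianVarietiesComplex, §5.4.1 (5.22)–(5.23) (PDF p. 275); §7.3.2 (1), (3)] [cite: Huybrechts2016K3, Ch. 14 §0.1] -/
theorem IsPolarizationType.finrank_lefschetzImage_eq_finrank_orthogonal_primitive (hd : IsPolarizationType Φ η d)
    (hη : IsRiemannForm Φ η) (hpq : 2 * p + 2 + q = j + 2) (hq : q ≤ j + 2) {γ : E [⋀^Fin (2 * q)]→L[ℝ] ℂ}
    (hγ : wedgePow (ofRealForm η) q = ((q.factorial * ∏ i : Fin q, d (Fin.castLE hq i) : ℕ) : ℂ) • γ)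
    (hq2 : q + 1 + 1 ≤ j + 2) {γ' : E [⋀^Fin (2 * (q + 1 + 1))]→L[ℝ] ℂ}
    (hγ' : wedgePow (ofRealForm η) (q + 1 + 1) =
      (((q + 1 + 1).factorial * ∏ i : Fin (q + 1 + 1), d (Fin.castLE hq2 i) : ℕ) : ℂ) • γ')
    (e : Fin n ≃ ι) (hn : 2 * p + 2 + (2 * q + (2 * p + 2)) = n) (hn₂ : 2 * p + (2 * (q + 1 + 1) + 2 * p) = n)
    {B : BilinForm ℤ ↥(integralForms Φ (2 * p + 2))}
    (hB : ∀ x y : ↥(integralForms Φ (2 * p + 2)),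
      ((B x y : ℤ) : ℂ) = poincarePairing Φ e hn (x : E [⋀^Fin (2 * p + 2)]→L[ℝ] ℂ) (γ.wedge (y : E [⋀^Fin (2 * p + 2)]→L[ℝ] ℂ)))
    {B' : BilinForm ℤ ↥(integralForms Φ (2 * p))}
    (hB' : ∀ x y : ↥(integralForms Φ (2 * p)),
      ((B' x y : ℤ) : ℂ) = poincarePairing Φ e hn₂ (x : E [⋀^Fin (2 * p)]→L[ℝ] ℂ) (γ'.wedge (y : E [⋀^Fin (2 * p)]→L[ℝ] ℂ)))
    {M : Submodule ℤ ↥(integralForms Φ (2 * p + 2))}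
    (hM : ∀ x : ↥(integralForms Φ (2 * p + 2)), x ∈ M ↔ IsOfTypeAt (p + 1) (p + 1) (x : E [⋀^Fin (2 * p + 2)]→L[ℝ] ℂ))
    {M' : Submodule ℤ ↥(integralForms Φ (2 * p))}
    (hM' : ∀ x : ↥(integralForms Φ (2 * p)), x ∈ M' ↔ IsOfTypeAt p p (x : E [⋀^Fin (2 * p)]→L[ℝ] ℂ))
    (hM'n : (B'.restrict M').Nondegenerate) (T : ↥M' →ₗ[ℤ] ↥M)
    (hT : ∀ x : ↥M', (((T x : ↥M) : ↥(integralForms Φ (2 * p + 2))) : E [⋀^Fin (2 * p + 2)]→L[ℝ] ℂ) =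
      (((x : ↥M') : ↥(integralForms Φ (2 * p))) : E [⋀^Fin (2 * p)]→L[ℝ] ℂ).wedge (ofRealForm η : E [⋀^Fin 2]→L[ℝ] ℂ))
    {L₂ : Submodule ℤ ↥M} (hmemL₂ : ∀ u : ↥M, u ∈ L₂ ↔ ∃ w : ↥M', T w = u) {P : Submodule ℤ ↥M}
    (hP : ∀ z : ↥M, z ∈ P ↔ (((z : ↥M) : ↥(integralForms Φ (2 * p + 2))) : E [⋀^Fin (2 * p + 2)]→L[ℝ] ℂ) ∈ primitiveForms η (2 * p + 2)) :
    finrank ℤ ↥L₂ = finrank ℤ ↥((B.restrict M).orthogonal P) := by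
  classical
  letI : LinearOrder ι := linearOrderOfOrientation e
  have sb := Submodule.basisOfPid (intLatMonomialBasis Φ (2 * p + 2)) M
  haveI : Module.Finite ℤ ↥M := Module.Finite.of_basis sb.2
  haveI : Module.Free ℤ ↥M := Module.Free.of_basis sb.2
  have hBs : (B.restrict M).IsSymm :=
    (hd.isSymm_of_eq_poincarePairing_wedge_of_even hη ⟨p + 1, by ring⟩ hpq hq hγ e hn hB).restrict M
  have hc0 := (hd.lefschetz_ratio_pos hη hq2 (q := q)).ne'
  have hBT := hd.apply_lefschetz_linearMap hη hq hγ hq2 hγ' e hn hn₂ hB hB' T hT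
  -- `B_M∣L₂` is non-degenerate: `B(T x, T y) = c·B'(x, y)` and `B'∣M'` is non-degenerate
  have hL₂n : ((B.restrict M).restrict L₂).Nondegenerate := by
    have key : ∀ u : ↥L₂, (∀ v : ↥L₂, B (((u : ↥L₂) : ↥M) : ↥(integralForms Φ (2 * p + 2))) (((v : ↥L₂) : ↥M) : ↥(integralForms Φ (2 * p + 2))) = 0) → u = 0 := by
      intro u hu
      obtain ⟨x, hx⟩ := (hmemL₂ (u : ↥M)).1 u.2
      have hx0 : x = 0 := hM'n.1 x fun y ↦ by
        have h1 := hu ⟨T y, (hmemL₂ _).2 ⟨y, rfl⟩⟩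
        change B ((u : ↥M) : ↥(integralForms Φ (2 * p + 2))) ((T y : ↥M) : ↥(integralForms Φ (2 * p + 2))) = 0 at h1
        rw [← hx, hBT] at h1
        exact (mul_eq_zero.1 h1).resolve_left hc0
      rw [hx0, map_zero] at hx
      exact Subtype.ext hx.symm
    refine ⟨fun u hu ↦ key u fun v ↦ hu v, fun u hu ↦ key u fun v ↦ ?_⟩
    have h := hu v
    change B (((v : ↥L₂) : ↥M) : ↥(integralForms Φ (2 * p + 2))) (((u : ↥L₂) : ↥M) : ↥(integralForms Φ (2 * p + 2))) = 0 at h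
    rw [← (hd.isSymm_of_eq_poincarePairing_wedge_of_even hη ⟨p + 1, by ring⟩ hpq hq hγ e hn hB).eq] at h
    exact h
  have hPn := (primitive_inf_orthogonal_eq_bot₈₁ hd hη hpq hq hγ e hn hB hM hP).2
  have h1 := LinearMap.BilinForm.finrank_add_finrank_orthogonal_of_nondegenerate (B.restrict M) L₂ hBs hL₂n
  have h2 := LinearMap.BilinForm.finrank_add_finrank_orthogonal_of_nondegenerate (B.restrict M) P hBs hPn
  rw [hd.orthogonal_lefschetzImage_eq_primitive hη hpq hq hγ hq2 hγ' e hn hn₂ hB hB' hM hM' hM'n T hT hmemL₂ hP] at h1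
  omega

end Orthogonality

/-! ## §3 The Gram matrix of `θ ∧ Hdgᵖ(X, ℤ)`: `G_{L₂} = c · G_{Hdgᵖ}`, `disc(θ ∧ Hdgᵖ) = c^{rk Hdgᵖ} · disc Hdgᵖ ≠ 0` -/

section Gram

variable {ι : Type*} [Fintype ι] [DecidableEq ι] {E : Type*} [NormedAddCommGroup E] [NormedSpace ℂ E]
  {Φ : (ι → ℝ) ≃L[ℝ] E} {j n p q : ℕ} {η : E [⋀^Fin 2]→L[ℝ] ℝ} {d : Fin (j + 2) → ℕ}

/-- **The basis `T b'` of the Lefschetz image**: a `ℤ`-basis `b'` of `Hdgᵖ(X, ℤ)` is carried by the (injective) Lefschetz map to a `ℤ`-basis of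
`L₂ = θ ∧ Hdgᵖ(X, ℤ)` indexed by the same set. [cite: Lange2023AbelianVarietiesComplex, §5.4.1 (5.22) (PDF p. 275); §7.3.2 (1)] [cite: VoisinHodgeI2002, §6.2.3 Lemma 6.26] -/
theorem IsPolarizationType.exists_basis_lefschetzImage (hd : IsPolarizationType Φ η d) (hη : IsRiemannForm Φ η) (hq : q ≤ j + 2)
    {γ : E [⋀^Fin (2 * q)]→L[ℝ] ℂ} (hγ : wedgePow (ofRealForm η) q = ((q.factorial * ∏ i : Fin q, d (Fin.castLE hq i) : ℕ) : ℂ) • γ)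
    (hq2 : q + 1 + 1 ≤ j + 2) {γ' : E [⋀^Fin (2 * (q + 1 + 1))]→L[ℝ] ℂ}
    (hγ' : wedgePow (ofRealForm η) (q + 1 + 1) =
      (((q + 1 + 1).factorial * ∏ i : Fin (q + 1 + 1), d (Fin.castLE hq2 i) : ℕ) : ℂ) • γ')
    (e : Fin n ≃ ι) (hn : 2 * p + 2 + (2 * q + (2 * p + 2)) = n) (hn₂ : 2 * p + (2 * (q + 1 + 1) + 2 * p) = n)
    {B : BilinForm ℤ ↥(integralForms Φ (2 * p + 2))}
    (hB : ∀ x y : ↥(integralForms Φ (2 * p + 2)),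
      ((B x y : ℤ) : ℂ) = poincarePairing Φ e hn (x : E [⋀^Fin (2 * p + 2)]→L[ℝ] ℂ) (γ.wedge (y : E [⋀^Fin (2 * p + 2)]→L[ℝ] ℂ)))
    {B' : BilinForm ℤ ↥(integralForms Φ (2 * p))}
    (hB' : ∀ x y : ↥(integralForms Φ (2 * p)),
      ((B' x y : ℤ) : ℂ) = poincarePairing Φ e hn₂ (x : E [⋀^Fin (2 * p)]→L[ℝ] ℂ) (γ'.wedge (y : E [⋀^Fin (2 * p)]→L[ℝ] ℂ)))
    {M : Submodule ℤ ↥(integralForms Φ (2 * p + 2))} {M' : Submodule ℤ ↥(integralForms Φ (2 * p))}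
    (hM'n : (B'.restrict M').Nondegenerate) (T : ↥M' →ₗ[ℤ] ↥M)
    (hT : ∀ x : ↥M', (((T x : ↥M) : ↥(integralForms Φ (2 * p + 2))) : E [⋀^Fin (2 * p + 2)]→L[ℝ] ℂ) =
      (((x : ↥M') : ↥(integralForms Φ (2 * p))) : E [⋀^Fin (2 * p)]→L[ℝ] ℂ).wedge (ofRealForm η : E [⋀^Fin 2]→L[ℝ] ℂ))
    {L₂ : Submodule ℤ ↥M} (hmemL₂ : ∀ u : ↥M, u ∈ L₂ ↔ ∃ w : ↥M', T w = u) {κ : Type*} (bM' : Basis κ ℤ ↥M') :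
    ∃ bL₂ : Basis κ ℤ ↥L₂, ∀ i, ((bL₂ i : ↥L₂) : ↥M) = T (bM' i) := by
  have hTinj := hd.lefschetz_linearMap_injective hη hq hγ hq2 hγ' e hn hn₂ hB hB' hM'n T hT
  have hrange : LinearMap.range T = L₂ := by
    ext u
    rw [LinearMap.mem_range]
    exact (hmemL₂ u).symm
  refine ⟨(bM'.map (LinearEquiv.ofInjective T hTinj)).map (LinearEquiv.ofEq _ _ hrange), fun i ↦ ?_⟩
  rw [Basis.map_apply, Basis.map_apply]
  rfl
set_option maxHeartbeats 400000 in -- buildfix (bf3-g31): 160k/180k FAIL, 200k PASS at accept time; line-neutral budget line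
/-- **The Gram matrix of the Lefschetz image is `c · G_{Hdgᵖ}`**: in a basis `b_{L₂}` of `L₂ = θ ∧ Hdgᵖ(X, ℤ)` of the form `T b'` (`hb`), the Gram
matrix of `B_{2p+2}` is `c` times the Gram matrix `G'` of `B_{2p}∣Hdgᵖ(X, ℤ)` in `b'`, `c = (q+1)(q+2)·d_{q+1}·d_{q+2}`.
[cite: Lange2023AbelianVarietiesComplex, §5.4.1 (5.22) (PDF p. 275); §2.5.3 Cor. 2.5.17 (PDF p. 135)] [cite: VoisinHodgeI2002, §6.3.2 Lemma 6.31 (PDF p. 128)] -/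
theorem IsPolarizationType.toMatrix_restrict_lefschetzImage_eq_smul (hd : IsPolarizationType Φ η d) (hη : IsRiemannForm Φ η)
    (hq : q ≤ j + 2) {γ : E [⋀^Fin (2 * q)]→L[ℝ] ℂ}
    (hγ : wedgePow (ofRealForm η) q = ((q.factorial * ∏ i : Fin q, d (Fin.castLE hq i) : ℕ) : ℂ) • γ)
    (hq2 : q + 1 + 1 ≤ j + 2) {γ' : E [⋀^Fin (2 * (q + 1 + 1))]→L[ℝ] ℂ}
    (hγ' : wedgePow (ofRealForm η) (q + 1 + 1) =
      (((q + 1 + 1).factorial * ∏ i : Fin (q + 1 + 1), d (Fin.castLE hq2 i) : ℕ) : ℂ) • γ')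
    (e : Fin n ≃ ι) (hn : 2 * p + 2 + (2 * q + (2 * p + 2)) = n) (hn₂ : 2 * p + (2 * (q + 1 + 1) + 2 * p) = n)
    {B : BilinForm ℤ ↥(integralForms Φ (2 * p + 2))}
    (hB : ∀ x y : ↥(integralForms Φ (2 * p + 2)),
      ((B x y : ℤ) : ℂ) = poincarePairing Φ e hn (x : E [⋀^Fin (2 * p + 2)]→L[ℝ] ℂ) (γ.wedge (y : E [⋀^Fin (2 * p + 2)]→L[ℝ] ℂ)))
    {B' : BilinForm ℤ ↥(integralForms Φ (2 * p))}
    (hB' : ∀ x y : ↥(integralForms Φ (2 * p)),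
      ((B' x y : ℤ) : ℂ) = poincarePairing Φ e hn₂ (x : E [⋀^Fin (2 * p)]→L[ℝ] ℂ) (γ'.wedge (y : E [⋀^Fin (2 * p)]→L[ℝ] ℂ)))
    {M : Submodule ℤ ↥(integralForms Φ (2 * p + 2))} {M' : Submodule ℤ ↥(integralForms Φ (2 * p))} (T : ↥M' →ₗ[ℤ] ↥M)
    (hT : ∀ x : ↥M', (((T x : ↥M) : ↥(integralForms Φ (2 * p + 2))) : E [⋀^Fin (2 * p + 2)]→L[ℝ] ℂ) =
      (((x : ↥M') : ↥(integralForms Φ (2 * p))) : E [⋀^Fin (2 * p)]→L[ℝ] ℂ).wedge (ofRealForm η : E [⋀^Fin 2]→L[ℝ] ℂ))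
    {L₂ : Submodule ℤ ↥M} {κ : Type*} [Fintype κ] [DecidableEq κ] (bM' : Basis κ ℤ ↥M') (bL₂ : Basis κ ℤ ↥L₂)
    (hb : ∀ i, ((bL₂ i : ↥L₂) : ↥M) = T (bM' i)) :
    LinearMap.BilinForm.toMatrix bL₂ ((B.restrict M).restrict L₂) =
      (((q + 1) * (q + 2) * d (Fin.castLE hq2 (Fin.last q).castSucc) * d (Fin.castLE hq2 (Fin.last (q + 1))) : ℕ) : ℤ) •
        LinearMap.BilinForm.toMatrix bM' (B'.restrict M') := by
  have hBT := hd.apply_lefschetz_linearMap hη hq hγ hq2 hγ' e hn hn₂ hB hB' T hT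
  ext i k
  rw [LinearMap.BilinForm.toMatrix_apply, Matrix.smul_apply, LinearMap.BilinForm.toMatrix_apply, smul_eq_mul]
  change B (((bL₂ i : ↥L₂) : ↥M) : ↥(integralForms Φ (2 * p + 2))) (((bL₂ k : ↥L₂) : ↥M) : ↥(integralForms Φ (2 * p + 2))) =
    (((q + 1) * (q + 2) * d (Fin.castLE hq2 (Fin.last q).castSucc) * d (Fin.castLE hq2 (Fin.last (q + 1))) : ℕ) : ℤ) *
      B' ((bM' i : ↥M') : ↥(integralForms Φ (2 * p))) ((bM' k : ↥M') : ↥(integralForms Φ (2 * p)))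
  rw [hb i, hb k]
  exact hBT _ _

/-- **`disc(θ ∧ Hdgᵖ(X, ℤ)) = c^{rk Hdgᵖ(X, ℤ)} · disc Hdgᵖ(X, ℤ)`**: the Gram determinant of the Lefschetz image in the basis `T b'` is
`c^{rk} · det G'` (`det (c · G') = c^{rk} det G'`). [cite: Lange2023AbelianVarietiesComplex, §5.4.1 (5.22) (PDF p. 275)] [cite: Huybrechts2016K3, Ch. 14 §0.1] -/
theorem IsPolarizationType.det_restrict_lefschetzImage_eq (hd : IsPolarizationType Φ η d) (hη : IsRiemannForm Φ η)
    (hq : q ≤ j + 2) {γ : E [⋀^Fin (2 * q)]→L[ℝ] ℂ}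
    (hγ : wedgePow (ofRealForm η) q = ((q.factorial * ∏ i : Fin q, d (Fin.castLE hq i) : ℕ) : ℂ) • γ)
    (hq2 : q + 1 + 1 ≤ j + 2) {γ' : E [⋀^Fin (2 * (q + 1 + 1))]→L[ℝ] ℂ}
    (hγ' : wedgePow (ofRealForm η) (q + 1 + 1) =
      (((q + 1 + 1).factorial * ∏ i : Fin (q + 1 + 1), d (Fin.castLE hq2 i) : ℕ) : ℂ) • γ')
    (e : Fin n ≃ ι) (hn : 2 * p + 2 + (2 * q + (2 * p + 2)) = n) (hn₂ : 2 * p + (2 * (q + 1 + 1) + 2 * p) = n)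
    {B : BilinForm ℤ ↥(integralForms Φ (2 * p + 2))}
    (hB : ∀ x y : ↥(integralForms Φ (2 * p + 2)),
      ((B x y : ℤ) : ℂ) = poincarePairing Φ e hn (x : E [⋀^Fin (2 * p + 2)]→L[ℝ] ℂ) (γ.wedge (y : E [⋀^Fin (2 * p + 2)]→L[ℝ] ℂ)))
    {B' : BilinForm ℤ ↥(integralForms Φ (2 * p))}
    (hB' : ∀ x y : ↥(integralForms Φ (2 * p)),
      ((B' x y : ℤ) : ℂ) = poincarePairing Φ e hn₂ (x : E [⋀^Fin (2 * p)]→L[ℝ] ℂ) (γ'.wedge (y : E [⋀^Fin (2 * p)]→L[ℝ] ℂ)))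
    {M : Submodule ℤ ↥(integralForms Φ (2 * p + 2))} {M' : Submodule ℤ ↥(integralForms Φ (2 * p))} (T : ↥M' →ₗ[ℤ] ↥M)
    (hT : ∀ x : ↥M', (((T x : ↥M) : ↥(integralForms Φ (2 * p + 2))) : E [⋀^Fin (2 * p + 2)]→L[ℝ] ℂ) =
      (((x : ↥M') : ↥(integralForms Φ (2 * p))) : E [⋀^Fin (2 * p)]→L[ℝ] ℂ).wedge (ofRealForm η : E [⋀^Fin 2]→L[ℝ] ℂ))
    {L₂ : Submodule ℤ ↥M} {κ : Type*} [Fintype κ] [DecidableEq κ] (bM' : Basis κ ℤ ↥M') (bL₂ : Basis κ ℤ ↥L₂)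
    (hb : ∀ i, ((bL₂ i : ↥L₂) : ↥M) = T (bM' i)) :
    (LinearMap.BilinForm.toMatrix bL₂ ((B.restrict M).restrict L₂)).det =
      (((q + 1) * (q + 2) * d (Fin.castLE hq2 (Fin.last q).castSucc) * d (Fin.castLE hq2 (Fin.last (q + 1))) : ℕ) : ℤ) ^ Fintype.card κ *
        (LinearMap.BilinForm.toMatrix bM' (B'.restrict M')).det := by
  rw [hd.toMatrix_restrict_lefschetzImage_eq_smul hη hq hγ hq2 hγ' e hn hn₂ hB hB' T hT bM' bL₂ hb, Matrix.det_smul]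

/-- **`disc(θ ∧ Hdgᵖ(X, ℤ)) ≠ 0`** (`c > 0` and `det G' ≠ 0`, `B_{2p}∣Hdgᵖ(X, ℤ)` being non-degenerate). [cite: Lange2023AbelianVarietiesComplex, §5.4.1 (5.22) (PDF p. 275)] [cite: Huybrechts2016K3, Ch. 14 §0.1] -/
theorem IsPolarizationType.det_restrict_lefschetzImage_ne_zero (hd : IsPolarizationType Φ η d) (hη : IsRiemannForm Φ η)
    (hq : q ≤ j + 2) {γ : E [⋀^Fin (2 * q)]→L[ℝ] ℂ}
    (hγ : wedgePow (ofRealForm η) q = ((q.factorial * ∏ i : Fin q, d (Fin.castLE hq i) : ℕ) : ℂ) • γ)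
    (hq2 : q + 1 + 1 ≤ j + 2) {γ' : E [⋀^Fin (2 * (q + 1 + 1))]→L[ℝ] ℂ}
    (hγ' : wedgePow (ofRealForm η) (q + 1 + 1) =
      (((q + 1 + 1).factorial * ∏ i : Fin (q + 1 + 1), d (Fin.castLE hq2 i) : ℕ) : ℂ) • γ')
    (e : Fin n ≃ ι) (hn : 2 * p + 2 + (2 * q + (2 * p + 2)) = n) (hn₂ : 2 * p + (2 * (q + 1 + 1) + 2 * p) = n)
    {B : BilinForm ℤ ↥(integralForms Φ (2 * p + 2))}
    (hB : ∀ x y : ↥(integralForms Φ (2 * p + 2)),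
      ((B x y : ℤ) : ℂ) = poincarePairing Φ e hn (x : E [⋀^Fin (2 * p + 2)]→L[ℝ] ℂ) (γ.wedge (y : E [⋀^Fin (2 * p + 2)]→L[ℝ] ℂ)))
    {B' : BilinForm ℤ ↥(integralForms Φ (2 * p))}
    (hB' : ∀ x y : ↥(integralForms Φ (2 * p)),
      ((B' x y : ℤ) : ℂ) = poincarePairing Φ e hn₂ (x : E [⋀^Fin (2 * p)]→L[ℝ] ℂ) (γ'.wedge (y : E [⋀^Fin (2 * p)]→L[ℝ] ℂ)))
    {M : Submodule ℤ ↥(integralForms Φ (2 * p + 2))} {M' : Submodule ℤ ↥(integralForms Φ (2 * p))}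
    (hM'n : (B'.restrict M').Nondegenerate) (T : ↥M' →ₗ[ℤ] ↥M)
    (hT : ∀ x : ↥M', (((T x : ↥M) : ↥(integralForms Φ (2 * p + 2))) : E [⋀^Fin (2 * p + 2)]→L[ℝ] ℂ) =
      (((x : ↥M') : ↥(integralForms Φ (2 * p))) : E [⋀^Fin (2 * p)]→L[ℝ] ℂ).wedge (ofRealForm η : E [⋀^Fin 2]→L[ℝ] ℂ))
    {L₂ : Submodule ℤ ↥M} {κ : Type*} [Fintype κ] [DecidableEq κ] (bM' : Basis κ ℤ ↥M') (bL₂ : Basis κ ℤ ↥L₂)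
    (hb : ∀ i, ((bL₂ i : ↥L₂) : ↥M) = T (bM' i)) :
    (LinearMap.BilinForm.toMatrix bL₂ ((B.restrict M).restrict L₂)).det ≠ 0 := by
  rw [hd.det_restrict_lefschetzImage_eq hη hq hγ hq2 hγ' e hn hn₂ hB hB' T hT bM' bL₂ hb]
  exact mul_ne_zero (pow_ne_zero _ (hd.lefschetz_ratio_pos hη hq2 (q := q)).ne')
    ((LinearMap.BilinForm.nondegenerate_iff_det_ne_zero bM').1 hM'n)

end Gram

/-! ## §4 The discriminant/index recursion along the Lefschetz ladder -/

section Recursion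

variable {ι : Type*} [Fintype ι] [DecidableEq ι] {E : Type*} [NormedAddCommGroup E] [NormedSpace ℂ E]
  {Φ : (ι → ℝ) ≃L[ℝ] E} {j n p q : ℕ} {η : E [⋀^Fin 2]→L[ℝ] ℝ} {d : Fin (j + 2) → ℕ}

set_option maxHeartbeats 4000000 in
/-- **THE DISCRIMINANT/INDEX RECURSION: `disc(θ ∧ Hdgᵖ(X, ℤ)) · disc Hdgᵖ⁺¹(X, ℤ)_prim = [Hdgᵖ⁺¹(X, ℤ) : θ ∧ Hdgᵖ(X, ℤ) ⊕ Hdgᵖ⁺¹(X, ℤ)_prim]² · disc Hdgᵖ⁺¹(X, ℤ)`**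
in any `ℤ`-bases `b_M` of `M = Hdgᵖ⁺¹(X, ℤ)`, `b_{L₂} = T b'` of the Lefschetz image and `c_P` of the primitive Hodge lattice: Huybrechts' (0.2)
`disc Λ · disc Λ^⊥ = (Γ : Λ ⊕ Λ^⊥)² · disc Γ` for `Λ = θ ∧ Hdgᵖ(X, ℤ)`, whose orthogonal inside `Hdgᵖ⁺¹(X, ℤ)` is EXACTLY `P` (§2) and whose Gram
determinant is non-zero (§3) — Kitaoka's Prop. 5.3.3 for the Lefschetz ladder of integral Hodge lattices.
[cite: Huybrechts2016K3, Ch. 14 §0.1 (0.2), §0.2] [cite: Kitaoka1993, Ch. 5 Prop. 5.3.3 (proof)] [cite: VoisinHodgeI2002, §6.3.2 Lemma 6.31 (PDF p. 128)] [cite: Lange2023AbelianVarietiesComplex, §5.4.1 (5.22)–(5.23) (PDF p. 275)] -/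
theorem IsPolarizationType.det_lefschetzImage_mul_det_primitive_eq_index_sq_mul_det (hd : IsPolarizationType Φ η d)
    (hη : IsRiemannForm Φ η) (hpq : 2 * p + 2 + q = j + 2) (hq : q ≤ j + 2) {γ : E [⋀^Fin (2 * q)]→L[ℝ] ℂ}
    (hγ : wedgePow (ofRealForm η) q = ((q.factorial * ∏ i : Fin q, d (Fin.castLE hq i) : ℕ) : ℂ) • γ)
    (hq2 : q + 1 + 1 ≤ j + 2) {γ' : E [⋀^Fin (2 * (q + 1 + 1))]→L[ℝ] ℂ}
    (hγ' : wedgePow (ofRealForm η) (q + 1 + 1) =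
      (((q + 1 + 1).factorial * ∏ i : Fin (q + 1 + 1), d (Fin.castLE hq2 i) : ℕ) : ℂ) • γ')
    (e : Fin n ≃ ι) (hn : 2 * p + 2 + (2 * q + (2 * p + 2)) = n) (hn₂ : 2 * p + (2 * (q + 1 + 1) + 2 * p) = n)
    {B : BilinForm ℤ ↥(integralForms Φ (2 * p + 2))}
    (hB : ∀ x y : ↥(integralForms Φ (2 * p + 2)),
      ((B x y : ℤ) : ℂ) = poincarePairing Φ e hn (x : E [⋀^Fin (2 * p + 2)]→L[ℝ] ℂ) (γ.wedge (y : E [⋀^Fin (2 * p + 2)]→L[ℝ] ℂ)))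
    {B' : BilinForm ℤ ↥(integralForms Φ (2 * p))}
    (hB' : ∀ x y : ↥(integralForms Φ (2 * p)),
      ((B' x y : ℤ) : ℂ) = poincarePairing Φ e hn₂ (x : E [⋀^Fin (2 * p)]→L[ℝ] ℂ) (γ'.wedge (y : E [⋀^Fin (2 * p)]→L[ℝ] ℂ)))
    {M : Submodule ℤ ↥(integralForms Φ (2 * p + 2))}
    (hM : ∀ x : ↥(integralForms Φ (2 * p + 2)), x ∈ M ↔ IsOfTypeAt (p + 1) (p + 1) (x : E [⋀^Fin (2 * p + 2)]→L[ℝ] ℂ))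
    {M' : Submodule ℤ ↥(integralForms Φ (2 * p))}
    (hM' : ∀ x : ↥(integralForms Φ (2 * p)), x ∈ M' ↔ IsOfTypeAt p p (x : E [⋀^Fin (2 * p)]→L[ℝ] ℂ))
    (hM'n : (B'.restrict M').Nondegenerate) (T : ↥M' →ₗ[ℤ] ↥M)
    (hT : ∀ x : ↥M', (((T x : ↥M) : ↥(integralForms Φ (2 * p + 2))) : E [⋀^Fin (2 * p + 2)]→L[ℝ] ℂ) =
      (((x : ↥M') : ↥(integralForms Φ (2 * p))) : E [⋀^Fin (2 * p)]→L[ℝ] ℂ).wedge (ofRealForm η : E [⋀^Fin 2]→L[ℝ] ℂ))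
    {L₂ : Submodule ℤ ↥M} (hmemL₂ : ∀ u : ↥M, u ∈ L₂ ↔ ∃ w : ↥M', T w = u) {P : Submodule ℤ ↥M}
    (hP : ∀ z : ↥M, z ∈ P ↔ (((z : ↥M) : ↥(integralForms Φ (2 * p + 2))) : E [⋀^Fin (2 * p + 2)]→L[ℝ] ℂ) ∈ primitiveForms η (2 * p + 2))
    {ι' κ κP : Type*} [Fintype ι'] [DecidableEq ι'] [Fintype κ] [DecidableEq κ] [Fintype κP] [DecidableEq κP]
    (bM : Basis ι' ℤ ↥M) (bM' : Basis κ ℤ ↥M') (bL₂ : Basis κ ℤ ↥L₂) (hb : ∀ i, ((bL₂ i : ↥L₂) : ↥M) = T (bM' i))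
    (cP : Basis κP ℤ ↥P) :
    (LinearMap.BilinForm.toMatrix bL₂ ((B.restrict M).restrict L₂)).det * (LinearMap.BilinForm.toMatrix cP ((B.restrict M).restrict P)).det =
      ((L₂ ⊔ P).toAddSubgroup.index : ℤ) ^ 2 * (LinearMap.BilinForm.toMatrix bM (B.restrict M)).det := by
  haveI : Module.Finite ℤ ↥M := Module.Finite.of_basis bM
  haveI : Module.Free ℤ ↥M := Module.Free.of_basis bM
  have hBs : (B.restrict M).IsSymm :=
    (hd.isSymm_of_eq_poincarePairing_wedge_of_even hη ⟨p + 1, by ring⟩ hpq hq hγ e hn hB).restrict M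
  have hdet := hd.det_restrict_lefschetzImage_ne_zero hη hq hγ hq2 hγ' e hn hn₂ hB hB' hM'n T hT bM' bL₂ hb
  have horth := hd.orthogonal_lefschetzImage_eq_primitive hη hpq hq hγ hq2 hγ' e hn hn₂ hB hB' hM hM' hM'n T hT hmemL₂ hP
  subst horth
  exact LinearMap.BilinForm.det_mul_det_orthogonal_eq_index_sq_mul_of_det_ne_zero (B.restrict M) L₂ hBs bM bL₂ cP hdet

set_option maxHeartbeats 4000000 in
/-- **The recursion in closed form: `c^{rk Hdgᵖ} · disc Hdgᵖ(X, ℤ) · disc Hdgᵖ⁺¹(X, ℤ)_prim = [Hdgᵖ⁺¹ : θ ∧ Hdgᵖ ⊕ Hdgᵖ⁺¹_prim]² · disc Hdgᵖ⁺¹(X, ℤ)`**,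
`c = (q+1)(q+2)·d_{q+1}·d_{q+2}` — the discriminants of consecutive integral Hodge lattices determine each other through the primitive
discriminant and the index of the integral Lefschetz decomposition. [cite: Huybrechts2016K3, Ch. 14 §0.1 (0.1), (0.2)] [cite: Kitaoka1993, Ch. 5 Prop. 5.3.3 (proof)] [cite: Lange2023AbelianVarietiesComplex, §5.4.1 (5.22)–(5.23) (PDF p. 275)] -/
theorem IsPolarizationType.pow_mul_det_mul_det_primitive_eq_index_sq_mul_det (hd : IsPolarizationType Φ η d)
    (hη : IsRiemannForm Φ η) (hpq : 2 * p + 2 + q = j + 2) (hq : q ≤ j + 2) {γ : E [⋀^Fin (2 * q)]→L[ℝ] ℂ}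
    (hγ : wedgePow (ofRealForm η) q = ((q.factorial * ∏ i : Fin q, d (Fin.castLE hq i) : ℕ) : ℂ) • γ)
    (hq2 : q + 1 + 1 ≤ j + 2) {γ' : E [⋀^Fin (2 * (q + 1 + 1))]→L[ℝ] ℂ}
    (hγ' : wedgePow (ofRealForm η) (q + 1 + 1) =
      (((q + 1 + 1).factorial * ∏ i : Fin (q + 1 + 1), d (Fin.castLE hq2 i) : ℕ) : ℂ) • γ')
    (e : Fin n ≃ ι) (hn : 2 * p + 2 + (2 * q + (2 * p + 2)) = n) (hn₂ : 2 * p + (2 * (q + 1 + 1) + 2 * p) = n)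
    {B : BilinForm ℤ ↥(integralForms Φ (2 * p + 2))}
    (hB : ∀ x y : ↥(integralForms Φ (2 * p + 2)),
      ((B x y : ℤ) : ℂ) = poincarePairing Φ e hn (x : E [⋀^Fin (2 * p + 2)]→L[ℝ] ℂ) (γ.wedge (y : E [⋀^Fin (2 * p + 2)]→L[ℝ] ℂ)))
    {B' : BilinForm ℤ ↥(integralForms Φ (2 * p))}
    (hB' : ∀ x y : ↥(integralForms Φ (2 * p)),
      ((B' x y : ℤ) : ℂ) = poincarePairing Φ e hn₂ (x : E [⋀^Fin (2 * p)]→L[ℝ] ℂ) (γ'.wedge (y : E [⋀^Fin (2 * p)]→L[ℝ] ℂ)))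
    {M : Submodule ℤ ↥(integralForms Φ (2 * p + 2))}
    (hM : ∀ x : ↥(integralForms Φ (2 * p + 2)), x ∈ M ↔ IsOfTypeAt (p + 1) (p + 1) (x : E [⋀^Fin (2 * p + 2)]→L[ℝ] ℂ))
    {M' : Submodule ℤ ↥(integralForms Φ (2 * p))}
    (hM' : ∀ x : ↥(integralForms Φ (2 * p)), x ∈ M' ↔ IsOfTypeAt p p (x : E [⋀^Fin (2 * p)]→L[ℝ] ℂ))
    (hM'n : (B'.restrict M').Nondegenerate) (T : ↥M' →ₗ[ℤ] ↥M)
    (hT : ∀ x : ↥M', (((T x : ↥M) : ↥(integralForms Φ (2 * p + 2))) : E [⋀^Fin (2 * p + 2)]→L[ℝ] ℂ) =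
      (((x : ↥M') : ↥(integralForms Φ (2 * p))) : E [⋀^Fin (2 * p)]→L[ℝ] ℂ).wedge (ofRealForm η : E [⋀^Fin 2]→L[ℝ] ℂ))
    {L₂ : Submodule ℤ ↥M} (hmemL₂ : ∀ u : ↥M, u ∈ L₂ ↔ ∃ w : ↥M', T w = u) {P : Submodule ℤ ↥M}
    (hP : ∀ z : ↥M, z ∈ P ↔ (((z : ↥M) : ↥(integralForms Φ (2 * p + 2))) : E [⋀^Fin (2 * p + 2)]→L[ℝ] ℂ) ∈ primitiveForms η (2 * p + 2))
    {ι' κ κP : Type*} [Fintype ι'] [DecidableEq ι'] [Fintype κ] [DecidableEq κ] [Fintype κP] [DecidableEq κP]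
    (bM : Basis ι' ℤ ↥M) (bM' : Basis κ ℤ ↥M') (cP : Basis κP ℤ ↥P) :
    (((q + 1) * (q + 2) * d (Fin.castLE hq2 (Fin.last q).castSucc) * d (Fin.castLE hq2 (Fin.last (q + 1))) : ℕ) : ℤ) ^ Fintype.card κ *
        (LinearMap.BilinForm.toMatrix bM' (B'.restrict M')).det * (LinearMap.BilinForm.toMatrix cP ((B.restrict M).restrict P)).det =
      ((L₂ ⊔ P).toAddSubgroup.index : ℤ) ^ 2 * (LinearMap.BilinForm.toMatrix bM (B.restrict M)).det := by
  have Hb := hd.exists_basis_lefschetzImage hη hq hγ hq2 hγ' e hn hn₂ hB hB' hM'n T hT hmemL₂ bM'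
  obtain ⟨bL₂, hb⟩ := Hb
  rw [← hd.det_restrict_lefschetzImage_eq hη hq hγ hq2 hγ' e hn hn₂ hB hB' T hT bM' bL₂ hb]
  exact hd.det_lefschetzImage_mul_det_primitive_eq_index_sq_mul_det hη hpq hq hγ hq2 hγ' e hn hn₂ hB hB' hM hM' hM'n T hT hmemL₂ hP
    bM bM' bL₂ hb cP

set_option maxHeartbeats 4000000 in
/-- **`0 < [Hdgᵖ⁺¹(X, ℤ) : θ ∧ Hdgᵖ(X, ℤ) ⊕ Hdgᵖ⁺¹(X, ℤ)_prim]` and it divides `c^{rk Hdgᵖ} · |disc Hdgᵖ(X, ℤ)|`** (Kitaoka: `M/(L₂ ⊥ L₂^⊥) ↪ L₂^♯/L₂`,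
a group of order `|disc L₂| = c^{rk} · |disc Hdgᵖ|`; `L₂^⊥ = P`): the integral Lefschetz decomposition `Hdgᵖ⁺¹(X, ℤ) ⊇ θ ∧ Hdgᵖ(X, ℤ) ⊕ Hdgᵖ⁺¹(X, ℤ)_prim`
has FINITE index (Lange (5.22)), bounded by the discriminant of the previous Hodge lattice. [cite: Kitaoka1993, Ch. 5 Prop. 5.3.3 (proof)] [cite: Lange2023AbelianVarietiesComplex, §5.4.1 (5.22)–(5.23) (PDF p. 275); §7.3.2 (3)] [cite: Huybrechts2016K3, Ch. 14 §0.1–§0.2] -/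
theorem IsPolarizationType.index_lefschetzImage_sup_primitive_pos_dvd (hd : IsPolarizationType Φ η d)
    (hη : IsRiemannForm Φ η) (hpq : 2 * p + 2 + q = j + 2) (hq : q ≤ j + 2) {γ : E [⋀^Fin (2 * q)]→L[ℝ] ℂ}
    (hγ : wedgePow (ofRealForm η) q = ((q.factorial * ∏ i : Fin q, d (Fin.castLE hq i) : ℕ) : ℂ) • γ)
    (hq2 : q + 1 + 1 ≤ j + 2) {γ' : E [⋀^Fin (2 * (q + 1 + 1))]→L[ℝ] ℂ}
    (hγ' : wedgePow (ofRealForm η) (q + 1 + 1) =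
      (((q + 1 + 1).factorial * ∏ i : Fin (q + 1 + 1), d (Fin.castLE hq2 i) : ℕ) : ℂ) • γ')
    (e : Fin n ≃ ι) (hn : 2 * p + 2 + (2 * q + (2 * p + 2)) = n) (hn₂ : 2 * p + (2 * (q + 1 + 1) + 2 * p) = n)
    {B : BilinForm ℤ ↥(integralForms Φ (2 * p + 2))}
    (hB : ∀ x y : ↥(integralForms Φ (2 * p + 2)),
      ((B x y : ℤ) : ℂ) = poincarePairing Φ e hn (x : E [⋀^Fin (2 * p + 2)]→L[ℝ] ℂ) (γ.wedge (y : E [⋀^Fin (2 * p + 2)]→L[ℝ] ℂ)))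
    {B' : BilinForm ℤ ↥(integralForms Φ (2 * p))}
    (hB' : ∀ x y : ↥(integralForms Φ (2 * p)),
      ((B' x y : ℤ) : ℂ) = poincarePairing Φ e hn₂ (x : E [⋀^Fin (2 * p)]→L[ℝ] ℂ) (γ'.wedge (y : E [⋀^Fin (2 * p)]→L[ℝ] ℂ)))
    {M : Submodule ℤ ↥(integralForms Φ (2 * p + 2))}
    (hM : ∀ x : ↥(integralForms Φ (2 * p + 2)), x ∈ M ↔ IsOfTypeAt (p + 1) (p + 1) (x : E [⋀^Fin (2 * p + 2)]→L[ℝ] ℂ))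
    {M' : Submodule ℤ ↥(integralForms Φ (2 * p))}
    (hM' : ∀ x : ↥(integralForms Φ (2 * p)), x ∈ M' ↔ IsOfTypeAt p p (x : E [⋀^Fin (2 * p)]→L[ℝ] ℂ))
    (hM'n : (B'.restrict M').Nondegenerate) (T : ↥M' →ₗ[ℤ] ↥M)
    (hT : ∀ x : ↥M', (((T x : ↥M) : ↥(integralForms Φ (2 * p + 2))) : E [⋀^Fin (2 * p + 2)]→L[ℝ] ℂ) =
      (((x : ↥M') : ↥(integralForms Φ (2 * p))) : E [⋀^Fin (2 * p)]→L[ℝ] ℂ).wedge (ofRealForm η : E [⋀^Fin 2]→L[ℝ] ℂ))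
    {L₂ : Submodule ℤ ↥M} (hmemL₂ : ∀ u : ↥M, u ∈ L₂ ↔ ∃ w : ↥M', T w = u) {P : Submodule ℤ ↥M}
    (hP : ∀ z : ↥M, z ∈ P ↔ (((z : ↥M) : ↥(integralForms Φ (2 * p + 2))) : E [⋀^Fin (2 * p + 2)]→L[ℝ] ℂ) ∈ primitiveForms η (2 * p + 2))
    {κ : Type*} [Fintype κ] [DecidableEq κ] (bM' : Basis κ ℤ ↥M') :
    0 < (L₂ ⊔ P).toAddSubgroup.index ∧
      (L₂ ⊔ P).toAddSubgroup.index ∣ ((((q + 1) * (q + 2) * d (Fin.castLE hq2 (Fin.last q).castSucc) *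
        d (Fin.castLE hq2 (Fin.last (q + 1))) : ℕ) : ℤ) ^ Fintype.card κ * (LinearMap.BilinForm.toMatrix bM' (B'.restrict M')).det).natAbs := by
  have hBs : (B.restrict M).IsSymm :=
    (hd.isSymm_of_eq_poincarePairing_wedge_of_even hη ⟨p + 1, by ring⟩ hpq hq hγ e hn hB).restrict M
  have Hb := hd.exists_basis_lefschetzImage hη hq hγ hq2 hγ' e hn hn₂ hB hB' hM'n T hT hmemL₂ bM'
  obtain ⟨bL₂, hb⟩ := Hb
  have hdet := hd.det_restrict_lefschetzImage_ne_zero hη hq hγ hq2 hγ' e hn hn₂ hB hB' hM'n T hT bM' bL₂ hb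
  rw [← hd.det_restrict_lefschetzImage_eq hη hq hγ hq2 hγ' e hn hn₂ hB hB' T hT bM' bL₂ hb]
  have horth := hd.orthogonal_lefschetzImage_eq_primitive hη hpq hq hγ hq2 hγ' e hn hn₂ hB hB' hM hM' hM'n T hT hmemL₂ hP
  subst horth
  exact ⟨Literature.Topology.FourManifolds.index_sup_orthogonal_pos (B.restrict M) L₂ hBs bL₂ hdet,
    Literature.Topology.FourManifolds.index_sup_orthogonal_dvd_natAbs_det (B.restrict M) L₂ hBs bL₂ hdet⟩

/-- **`[Hdgᵖ⁺¹ : P ⊕ P^⊥] ∣ [Hdgᵖ⁺¹ : θ ∧ Hdgᵖ ⊕ P]`**: the Lefschetz image lies in the Lefschetz part `P^⊥` (§2), so the index of g46-#9's primitive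
splitting divides the index of the integral Lefschetz decomposition (the quotient being `[P^⊥ : θ ∧ Hdgᵖ(X, ℤ)]`).
[cite: Lange2023AbelianVarietiesComplex, §5.4.1 (5.22)–(5.23) (PDF p. 275)] [cite: Huybrechts2016K3, Ch. 14 §0.2] -/
theorem IsPolarizationType.index_primitive_sup_orthogonal_dvd_index_lefschetzImage_sup (hd : IsPolarizationType Φ η d)
    (hη : IsRiemannForm Φ η) (hpq : 2 * p + 2 + q = j + 2) (hq : q ≤ j + 2) {γ : E [⋀^Fin (2 * q)]→L[ℝ] ℂ}
    (hγ : wedgePow (ofRealForm η) q = ((q.factorial * ∏ i : Fin q, d (Fin.castLE hq i) : ℕ) : ℂ) • γ)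
    (e : Fin n ≃ ι) (hn : 2 * p + 2 + (2 * q + (2 * p + 2)) = n) {B : BilinForm ℤ ↥(integralForms Φ (2 * p + 2))}
    (hB : ∀ x y : ↥(integralForms Φ (2 * p + 2)),
      ((B x y : ℤ) : ℂ) = poincarePairing Φ e hn (x : E [⋀^Fin (2 * p + 2)]→L[ℝ] ℂ) (γ.wedge (y : E [⋀^Fin (2 * p + 2)]→L[ℝ] ℂ)))
    {M : Submodule ℤ ↥(integralForms Φ (2 * p + 2))} {M' : Submodule ℤ ↥(integralForms Φ (2 * p))} (T : ↥M' →ₗ[ℤ] ↥M)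
    (hT : ∀ x : ↥M', (((T x : ↥M) : ↥(integralForms Φ (2 * p + 2))) : E [⋀^Fin (2 * p + 2)]→L[ℝ] ℂ) =
      (((x : ↥M') : ↥(integralForms Φ (2 * p))) : E [⋀^Fin (2 * p)]→L[ℝ] ℂ).wedge (ofRealForm η : E [⋀^Fin 2]→L[ℝ] ℂ))
    {L₂ : Submodule ℤ ↥M} (hmemL₂ : ∀ u : ↥M, u ∈ L₂ ↔ ∃ w : ↥M', T w = u) {P : Submodule ℤ ↥M}
    (hP : ∀ z : ↥M, z ∈ P ↔ (((z : ↥M) : ↥(integralForms Φ (2 * p + 2))) : E [⋀^Fin (2 * p + 2)]→L[ℝ] ℂ) ∈ primitiveForms η (2 * p + 2)) :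
    (P ⊔ (B.restrict M).orthogonal P).toAddSubgroup.index ∣ (L₂ ⊔ P).toAddSubgroup.index := by
  have hle : L₂ ⊔ P ≤ P ⊔ (B.restrict M).orthogonal P :=
    sup_le (le_sup_of_le_right (hd.lefschetzImage_le_orthogonal_primitive hη hpq hq hγ e hn hB T hT hmemL₂ hP)) le_sup_left
  exact AddSubgroup.index_dvd_of_le (show (L₂ ⊔ P).toAddSubgroup ≤ (P ⊔ (B.restrict M).orthogonal P).toAddSubgroup from hle)

end Recursion

/-! ## §5 A uniform exponent: `[Hdgᵖ⁺¹ : θ ∧ Hdgᵖ ⊕ P] · P^⊥ ⊆ θ ∧ Hdgᵖ(X, ℤ)` -/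

section Exponent

variable {ι : Type*} [Fintype ι] [DecidableEq ι] {E : Type*} [NormedAddCommGroup E] [NormedSpace ℂ E]
  {Φ : (ι → ℝ) ≃L[ℝ] E} {j n p q : ℕ} {η : E [⋀^Fin 2]→L[ℝ] ℝ} {d : Fin (j + 2) → ℕ}

/-- **UNIFORM EXPONENT OF THE LEFSCHETZ PART: `N · P^⊥ ⊆ θ ∧ Hdgᵖ(X, ℤ)` with `N = [Hdgᵖ⁺¹(X, ℤ) : θ ∧ Hdgᵖ(X, ℤ) ⊕ Hdgᵖ⁺¹(X, ℤ)_prim]`.** For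
`x ∈ P^⊥`: `N·x = l + z ∈ L₂ ⊕ P`; `z = N·x − l ∈ P^⊥` (as `L₂ ⊆ P^⊥`, §2), so `z ∈ P ∩ P^⊥ = 0` by Hodge–Riemann over `ℤ`, and `N·x = l ∈ L₂`.
Thus `P^⊥/(θ ∧ Hdgᵖ(X, ℤ))` is a finite group whose exponent divides `N` (which divides `c^{rk Hdgᵖ}·|disc Hdgᵖ(X, ℤ)|`, §4); g46-#11's
`P^⊥ = (θ ∧ Hdgᵖ)^{sat}` gets a multiplier independent of the class. [cite: Lange2023AbelianVarietiesComplex, §5.4.1 (5.22)–(5.23) (PDF p. 275); §7.3.2 (3)] [cite: VoisinHodgeI2002, §6.3.2 Lemma 6.31, Thm. 6.32 (PDF p. 128); §6.2.3 Rem. 6.27] [cite: Kitaoka1993, Ch. 5 Prop. 5.3.3 (proof)] -/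
theorem IsPolarizationType.index_nsmul_mem_lefschetzImage_of_mem_orthogonal_primitive (hd : IsPolarizationType Φ η d)
    (hη : IsRiemannForm Φ η) (hpq : 2 * p + 2 + q = j + 2) (hq : q ≤ j + 2) {γ : E [⋀^Fin (2 * q)]→L[ℝ] ℂ}
    (hγ : wedgePow (ofRealForm η) q = ((q.factorial * ∏ i : Fin q, d (Fin.castLE hq i) : ℕ) : ℂ) • γ)
    (e : Fin n ≃ ι) (hn : 2 * p + 2 + (2 * q + (2 * p + 2)) = n) {B : BilinForm ℤ ↥(integralForms Φ (2 * p + 2))}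
    (hB : ∀ x y : ↥(integralForms Φ (2 * p + 2)),
      ((B x y : ℤ) : ℂ) = poincarePairing Φ e hn (x : E [⋀^Fin (2 * p + 2)]→L[ℝ] ℂ) (γ.wedge (y : E [⋀^Fin (2 * p + 2)]→L[ℝ] ℂ)))
    {M : Submodule ℤ ↥(integralForms Φ (2 * p + 2))}
    (hM : ∀ x : ↥(integralForms Φ (2 * p + 2)), x ∈ M ↔ IsOfTypeAt (p + 1) (p + 1) (x : E [⋀^Fin (2 * p + 2)]→L[ℝ] ℂ))
    {M' : Submodule ℤ ↥(integralForms Φ (2 * p))} (T : ↥M' →ₗ[ℤ] ↥M)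
    (hT : ∀ x : ↥M', (((T x : ↥M) : ↥(integralForms Φ (2 * p + 2))) : E [⋀^Fin (2 * p + 2)]→L[ℝ] ℂ) =
      (((x : ↥M') : ↥(integralForms Φ (2 * p))) : E [⋀^Fin (2 * p)]→L[ℝ] ℂ).wedge (ofRealForm η : E [⋀^Fin 2]→L[ℝ] ℂ))
    {L₂ : Submodule ℤ ↥M} (hmemL₂ : ∀ u : ↥M, u ∈ L₂ ↔ ∃ w : ↥M', T w = u) {P : Submodule ℤ ↥M}
    (hP : ∀ z : ↥M, z ∈ P ↔ (((z : ↥M) : ↥(integralForms Φ (2 * p + 2))) : E [⋀^Fin (2 * p + 2)]→L[ℝ] ℂ) ∈ primitiveForms η (2 * p + 2))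
    {x : ↥M} (hx : x ∈ (B.restrict M).orthogonal P) :
    (L₂ ⊔ P).toAddSubgroup.index • x ∈ L₂ := by
  have hmem : (L₂ ⊔ P).toAddSubgroup.index • x ∈ L₂ ⊔ P := (L₂ ⊔ P).toAddSubgroup.nsmul_index_mem x
  obtain ⟨l, hl, z, hz, hlz⟩ := Submodule.mem_sup.1 hmem
  have hlO : l ∈ (B.restrict M).orthogonal P := hd.lefschetzImage_le_orthogonal_primitive hη hpq hq hγ e hn hB T hT hmemL₂ hP hl
  -- `z = N·x − l ∈ P^⊥`
  have hzO : z ∈ (B.restrict M).orthogonal P := by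
    have hz' : z = (L₂ ⊔ P).toAddSubgroup.index • x - l := by rw [← hlz, add_sub_cancel_left]
    rw [hz']
    exact Submodule.sub_mem _ (nsmul_mem hx _) hlO
  -- `z ∈ P ∩ P^⊥ = 0`
  have hz0 : z = 0 := (primitive_inf_orthogonal_eq_bot₈₁ hd hη hpq hq hγ e hn hB hM hP).1 z hz hzO
  rw [hz0, add_zero] at hlz
  rw [← hlz]
  exact hl

end Exponent

/-! ## §6 The concrete integral Hodge lattices: uniform multipliers -/

section Concrete

variable {ι : Type*} [Fintype ι] [DecidableEq ι] {E : Type*} [NormedAddCommGroup E] [NormedSpace ℂ E]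
  {Φ : (ι → ℝ) ≃L[ℝ] E} {j n p q : ℕ} {η : E [⋀^Fin 2]→L[ℝ] ℝ} {d : Fin (j + 2) → ℕ}

set_option maxHeartbeats 4000000 in
/-- **UNIFORM VERSION OF `P^⊥ = (θ ∧ Hdgᵖ(X, ℤ))^{sat}`**: for the integral Hodge lattice `Hdgᵖ⁺¹(X, ℤ)` of a polarised abelian variety with its Lefschetz
form `B_{2p+2}` and primitive sublattice `P`, **there is ONE `N ≥ 1` such that every `x ∈ Hdgᵖ⁺¹(X, ℤ)` orthogonal to `P` satisfies `N·x = β ∧ θ` with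
`β ∈ Hdgᵖ(X, ℤ)`** (`N` = the index of the integral Lefschetz decomposition `θ ∧ Hdgᵖ(X, ℤ) ⊕ P ⊆ Hdgᵖ⁺¹(X, ℤ)`; `B_{2p}∣Hdgᵖ(X, ℤ)` is non-degenerate
by g46-#1, so §§1–5 apply to the concrete lattices). [cite: Lange2023AbelianVarietiesComplex, §5.4.1 (5.22)–(5.23) (PDF p. 275); §7.3.2 (3); §7.2.2] [cite: VoisinHodgeI2002, §6.3.2 Lemma 6.31, Thm. 6.32 (PDF p. 128); §6.2.3 Rem. 6.27] -/
theorem IsPolarizationType.exists_forall_mem_orthogonal_primitive_nsmul_eq_wedge_ofRealForm (hd : IsPolarizationType Φ η d)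
    (hη : IsRiemannForm Φ η) (hkq : 2 * p + 2 + q = j + 2) (hq : q ≤ j + 2) {γ : E [⋀^Fin (2 * q)]→L[ℝ] ℂ}
    (hγ : wedgePow (ofRealForm η) q = ((q.factorial * ∏ i : Fin q, d (Fin.castLE hq i) : ℕ) : ℂ) • γ)
    (e : Fin n ≃ ι) (hn : 2 * p + 2 + (2 * q + (2 * p + 2)) = n) {B : BilinForm ℤ ↥(integralForms Φ (2 * p + 2))}
    (hB : ∀ x y : ↥(integralForms Φ (2 * p + 2)),
      ((B x y : ℤ) : ℂ) = poincarePairing Φ e hn (x : E [⋀^Fin (2 * p + 2)]→L[ℝ] ℂ) (γ.wedge (y : E [⋀^Fin (2 * p + 2)]→L[ℝ] ℂ)))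
    {P : Submodule ℤ ↥(AddSubgroup.toIntSubmodule ((integralHodgeClassesIn Φ (2 * p + 2) (p + 1)).addSubgroupOf (integralForms Φ (2 * p + 2))))}
    (hP : ∀ z, z ∈ P ↔ (((z : ↥(AddSubgroup.toIntSubmodule ((integralHodgeClassesIn Φ (2 * p + 2) (p + 1)).addSubgroupOf
      (integralForms Φ (2 * p + 2))))) : ↥(integralForms Φ (2 * p + 2))) : E [⋀^Fin (2 * p + 2)]→L[ℝ] ℂ) ∈ primitiveForms η (2 * p + 2)) :
    ∃ N : ℕ, 0 < N ∧ ∀ x : ↥(AddSubgroup.toIntSubmodule ((integralHodgeClassesIn Φ (2 * p + 2) (p + 1)).addSubgroupOf (integralForms Φ (2 * p + 2)))),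
      x ∈ (B.restrict (AddSubgroup.toIntSubmodule ((integralHodgeClassesIn Φ (2 * p + 2) (p + 1)).addSubgroupOf
        (integralForms Φ (2 * p + 2))))).orthogonal P →
      ∃ β ∈ integralHodgeClassesIn Φ (2 * p) p,
        (N : ℂ) • ((x : ↥(integralForms Φ (2 * p + 2))) : E [⋀^Fin (2 * p + 2)]→L[ℝ] ℂ) = β.wedge (ofRealForm η : E [⋀^Fin 2]→L[ℝ] ℂ) := by
  classical
  letI : LinearOrder ι := linearOrderOfOrientation e
  have hq2 : q + 1 + 1 ≤ j + 2 := by omega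
  obtain ⟨γ', hγ'Z, hγ'⟩ := hd.exists_mem_integralForms_wedgePow_eq_content_smul hq2
  have hn₂ : 2 * p + (2 * (q + 1 + 1) + 2 * p) = n := by omega
  obtain ⟨B', hB'⟩ := exists_bilinForm_eq_poincarePairing_wedge_of_degree Φ hγ'Z e hn₂
  have hM : ∀ x : ↥(integralForms Φ (2 * p + 2)),
      x ∈ AddSubgroup.toIntSubmodule ((integralHodgeClassesIn Φ (2 * p + 2) (p + 1)).addSubgroupOf (integralForms Φ (2 * p + 2))) ↔
        IsOfTypeAt (p + 1) (p + 1) (x : E [⋀^Fin (2 * p + 2)]→L[ℝ] ℂ) :=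
    mem_toIntSubmodule_integralHodgeClassesIn_iff Φ (by omega)
  have hM' : ∀ x : ↥(integralForms Φ (2 * p)),
      x ∈ AddSubgroup.toIntSubmodule ((integralHodgeClassesIn Φ (2 * p) p).addSubgroupOf (integralForms Φ (2 * p))) ↔
        IsOfTypeAt p p (x : E [⋀^Fin (2 * p)]→L[ℝ] ℂ) :=
    mem_toIntSubmodule_integralHodgeClassesIn_iff Φ (by omega)
  have H1 := hd.nondegenerate_finrank_sigPos_sigNeg_integralHodgeClassesIn_of_eq_poincarePairing_wedge hη (show p + p = 2 * p by omega)
    (show 2 * p + (q + 1 + 1) = j + 2 by omega) hq2 hγ' e hn₂ hB'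
  have hM'n := H1.1
  have HT := hη.exists_lefschetz_linearMap (p := p) hM hM'
  obtain ⟨T, hT⟩ := HT
  have hmemL₂ : ∀ u, u ∈ LinearMap.range T ↔ ∃ w, T w = u := fun u ↦ LinearMap.mem_range
  have sb' := Submodule.basisOfPid (intLatMonomialBasis Φ (2 * p))
    (AddSubgroup.toIntSubmodule ((integralHodgeClassesIn Φ (2 * p) p).addSubgroupOf (integralForms Φ (2 * p))))
  have Hidx := hd.index_lefschetzImage_sup_primitive_pos_dvd hη hkq hq hγ hq2 hγ' e hn hn₂ hB hB' hM hM' hM'n T hT hmemL₂ hP sb'.2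
  refine ⟨(LinearMap.range T ⊔ P).toAddSubgroup.index, Hidx.1, fun x hx ↦ ?_⟩
  have hmem := hd.index_nsmul_mem_lefschetzImage_of_mem_orthogonal_primitive hη hkq hq hγ e hn hB hM T hT hmemL₂ hP hx
  obtain ⟨β, hβ⟩ := LinearMap.mem_range.1 hmem
  refine ⟨((β : ↥(AddSubgroup.toIntSubmodule ((integralHodgeClassesIn Φ (2 * p) p).addSubgroupOf (integralForms Φ (2 * p))))) :
    ↥(integralForms Φ (2 * p))), AddSubgroup.mem_addSubgroupOf.1 β.2, ?_⟩
  rw [← hT β, hβ, Nat.cast_smul_eq_nsmul]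
  rfl

omit [DecidableEq ι] in
/-- **THE INTEGRAL LEFSCHETZ DECOMPOSITION OF HODGE CLASSES WITH A UNIFORM DENOMINATOR.** For a polarised abelian variety of dimension
`g = j + 2 = (2p + 2) + q` there is ONE integer `N ≥ 1` such that EVERY integral Hodge class `x ∈ Hdgᵖ⁺¹(X, ℤ) = H^{2p+2}(X, ℤ) ∩ H^{p+1,p+1}`
satisfies **`N·x = y₀ + β ∧ θ`** with `y₀ ∈ Hdgᵖ⁺¹(X, ℤ)` PRIMITIVE (`θ^{∧(q+1)} ∧ y₀ = 0`) and `β ∈ Hdgᵖ(X, ℤ)` — the rational Lefschetz decomposition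
`Bᵖ⁺¹(X) = Bᵖ⁺¹(X)_prim ⊕ L Bᵖ(X)` (Voisin Rem. 6.27, Lange §7.3.2 (3)) has BOUNDED denominators on the lattice, `N` being the (finite, Lange (5.22))
index `[Hdgᵖ⁺¹(X, ℤ) : θ ∧ Hdgᵖ(X, ℤ) ⊕ Hdgᵖ⁺¹(X, ℤ)_prim]` (g45-#3 §1 produced a multiplier depending on `x`). No form and no orientation enter the
statement. [cite: VoisinHodgeI2002, §6.2.3 Rem. 6.27 (PDF p. 126); §6.3.2 Lemma 6.31 (PDF p. 128); §7.1.2 (PDF p. 134)] [cite: Lange2023AbelianVarietiesComplex, §7.3.2 (3); §5.4.1 Thm. 5.4.2 and (5.22)–(5.23) (PDF p. 275); §7.2.2] [cite: Kitaoka1993, Ch. 5 Prop. 5.3.3 (proof)] -/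
theorem IsPolarizationType.exists_forall_nsmul_eq_primitive_add_wedge_ofRealForm (hd : IsPolarizationType Φ η d)
    (hη : IsRiemannForm Φ η) (hpq : 2 * p + 2 + q = j + 2) :
    ∃ N : ℕ, 0 < N ∧ ∀ x ∈ integralHodgeClassesIn Φ (2 * p + 2) (p + 1),
      ∃ y₀ ∈ integralHodgeClassesIn Φ (2 * p + 2) (p + 1), (wedgePow (ofRealForm η) (q + 1)).wedge y₀ = 0 ∧
        ∃ β ∈ integralHodgeClassesIn Φ (2 * p) p, (N : ℂ) • x = y₀ + β.wedge (ofRealForm η : E [⋀^Fin 2]→L[ℝ] ℂ) := by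
  classical
  haveI : FiniteDimensional ℝ E := Module.Finite.equiv Φ.toLinearEquiv
  haveI : FiniteDimensional ℂ E := Module.Finite.of_restrictScalars_finite ℝ ℂ E
  have hq : q ≤ j + 2 := by omega
  have hq2 : q + 1 + 1 ≤ j + 2 := by omega
  -- the data: orientation, minimal classes, Lefschetz forms, the primitive sublattice, the Lefschetz map
  let e : Fin (2 * (j + 2)) ≃ ι := (Fintype.equivFinOfCardEq hd.card_eq).symm
  letI : LinearOrder ι := linearOrderOfOrientation e
  obtain ⟨γ, hγZ, hγ⟩ := hd.exists_mem_integralForms_wedgePow_eq_content_smul hq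
  have hn : 2 * p + 2 + (2 * q + (2 * p + 2)) = 2 * (j + 2) := by omega
  obtain ⟨B, hB⟩ := exists_bilinForm_eq_poincarePairing_wedge_of_degree Φ hγZ e hn
  obtain ⟨γ', hγ'Z, hγ'⟩ := hd.exists_mem_integralForms_wedgePow_eq_content_smul hq2
  have hn₂ : 2 * p + (2 * (q + 1 + 1) + 2 * p) = 2 * (j + 2) := by omega
  obtain ⟨B', hB'⟩ := exists_bilinForm_eq_poincarePairing_wedge_of_degree Φ hγ'Z e hn₂
  obtain ⟨P, hP⟩ := exists_submodule_mem_iff_mem_primitiveForms Φ η (2 * p + 2) (p + 1)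
  have hM : ∀ x : ↥(integralForms Φ (2 * p + 2)),
      x ∈ AddSubgroup.toIntSubmodule ((integralHodgeClassesIn Φ (2 * p + 2) (p + 1)).addSubgroupOf (integralForms Φ (2 * p + 2))) ↔
        IsOfTypeAt (p + 1) (p + 1) (x : E [⋀^Fin (2 * p + 2)]→L[ℝ] ℂ) :=
    mem_toIntSubmodule_integralHodgeClassesIn_iff Φ (by omega)
  have hM' : ∀ x : ↥(integralForms Φ (2 * p)),
      x ∈ AddSubgroup.toIntSubmodule ((integralHodgeClassesIn Φ (2 * p) p).addSubgroupOf (integralForms Φ (2 * p))) ↔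
        IsOfTypeAt p p (x : E [⋀^Fin (2 * p)]→L[ℝ] ℂ) :=
    mem_toIntSubmodule_integralHodgeClassesIn_iff Φ (by omega)
  have H1 := hd.nondegenerate_finrank_sigPos_sigNeg_integralHodgeClassesIn_of_eq_poincarePairing_wedge hη (show p + p = 2 * p by omega)
    (show 2 * p + (q + 1 + 1) = j + 2 by omega) hq2 hγ' e hn₂ hB'
  have hM'n := H1.1
  have HT := hη.exists_lefschetz_linearMap (p := p) hM hM'
  obtain ⟨T, hT⟩ := HT
  have hmemL₂ : ∀ u, u ∈ LinearMap.range T ↔ ∃ w, T w = u := fun u ↦ LinearMap.mem_range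
  have sb' := Submodule.basisOfPid (intLatMonomialBasis Φ (2 * p))
    (AddSubgroup.toIntSubmodule ((integralHodgeClassesIn Φ (2 * p) p).addSubgroupOf (integralForms Φ (2 * p))))
  have Hidx := hd.index_lefschetzImage_sup_primitive_pos_dvd hη hpq hq hγ hq2 hγ' e hn hn₂ hB hB' hM hM' hM'n T hT hmemL₂ hP sb'.2
  refine ⟨(LinearMap.range T ⊔ P).toAddSubgroup.index, Hidx.1, fun x hx ↦ ?_⟩
  -- `N·x ∈ L₂ ⊕ P`
  let xM : ↥(AddSubgroup.toIntSubmodule ((integralHodgeClassesIn Φ (2 * p + 2) (p + 1)).addSubgroupOf (integralForms Φ (2 * p + 2)))) :=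
    ⟨⟨x, hx.1⟩, AddSubgroup.mem_addSubgroupOf.2 hx⟩
  have hmem : (LinearMap.range T ⊔ P).toAddSubgroup.index • xM ∈ LinearMap.range T ⊔ P :=
    (LinearMap.range T ⊔ P).toAddSubgroup.nsmul_index_mem xM
  obtain ⟨l, hl, z, hz, hlz⟩ := Submodule.mem_sup.1 hmem
  obtain ⟨β, rfl⟩ := LinearMap.mem_range.1 hl
  have hzH : (((z : ↥(AddSubgroup.toIntSubmodule ((integralHodgeClassesIn Φ (2 * p + 2) (p + 1)).addSubgroupOf
      (integralForms Φ (2 * p + 2))))) : ↥(integralForms Φ (2 * p + 2))) : E [⋀^Fin (2 * p + 2)]→L[ℝ] ℂ) ∈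
      integralHodgeClassesIn Φ (2 * p + 2) (p + 1) := AddSubgroup.mem_addSubgroupOf.1 z.2
  refine ⟨_, hzH, (hd.mem_primitiveForms_iff_wedgePow_wedge_eq_zero hpq _).1 ((hP z).1 hz),
    ((β : ↥(AddSubgroup.toIntSubmodule ((integralHodgeClassesIn Φ (2 * p) p).addSubgroupOf (integralForms Φ (2 * p))))) :
      ↥(integralForms Φ (2 * p))), AddSubgroup.mem_addSubgroupOf.1 β.2, ?_⟩
  have h := congrArg (fun w : ↥(AddSubgroup.toIntSubmodule ((integralHodgeClassesIn Φ (2 * p + 2) (p + 1)).addSubgroupOf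
    (integralForms Φ (2 * p + 2)))) ↦ ((w : ↥(integralForms Φ (2 * p + 2))) : E [⋀^Fin (2 * p + 2)]→L[ℝ] ℂ)) hlz
  have h' : (((T β : ↥(AddSubgroup.toIntSubmodule ((integralHodgeClassesIn Φ (2 * p + 2) (p + 1)).addSubgroupOf
      (integralForms Φ (2 * p + 2))))) : ↥(integralForms Φ (2 * p + 2))) : E [⋀^Fin (2 * p + 2)]→L[ℝ] ℂ) +
      (((z : ↥(AddSubgroup.toIntSubmodule ((integralHodgeClassesIn Φ (2 * p + 2) (p + 1)).addSubgroupOf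
        (integralForms Φ (2 * p + 2))))) : ↥(integralForms Φ (2 * p + 2))) : E [⋀^Fin (2 * p + 2)]→L[ℝ] ℂ) =
      ((LinearMap.range T ⊔ P).toAddSubgroup.index : ℂ) • x := by
    rw [Nat.cast_smul_eq_nsmul]
    exact h
  rw [← h', hT β]
  exact add_comm _ _

end Concrete

end Literature.Geometry.Kaehler.ComplexTorus

end
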